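import Literature.Computability.AlgebraicComplexity.KronRectDesignLetterMajor
import HarnessLib

/-!
# Design certificates for `k_m(δ) > 0`, MEMOISED: sub-designs, the expansion identity, and a verified
depth-first evaluator with a table of shared values

P. Bürgisser, C. Ikenmeyer, *Fundamental invariants of orbit closures*, J. Algebra **477** (2017)
[BurgisserIkenmeyer2017], §5 (Thm. 5.9 (2), Thm. 5.13: the invariants of triples of wedge lists /
obstruction designs, evaluated at the unit tensor); A. Amanov, D. Yeliussizov, IMRN 2023 =
arXiv:2202.11059 [AmanovYeliussizov2022], §7–§8 (Def. 7.4, Thm. 8.4 (ii): for an EVEN number of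
slices all labellings of one resolution of a magic set into diagonals carry the same sign, so the
signed count is `m!` times the normalised count; Cor. 8.5: a nonzero count gives `g₃(n,k) > 0`).

Companion of the tree's engines `AC/KronRectDesignCertificates.lean` (cell-major and pivot-major) and
`AC/KronRectDesignLetterMajor.lean` (letter-major; `normSum`, `kronRect_pos_of_normSum_ne_zero`,
stage-1 lists `diagList` with `mem_diagList_iff`). Those evaluators walk the resolution TREE; on the
`(13,6)` magic sets needed for `k_13(6)` (BI 2017 Problem 5.19, `e(23)`; cell `val-lit`) every tree
found has `≥ 2.8·10⁶` nodes. This file proves the identity that lets equal REMAINING sub-designs be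
merged (a DAG instead of a tree) and verifies an evaluator exploiting it:

* §1 sub-designs: for a set `s` of positions (bit mask), the normalised Latin colourings `LatinOn`
  of `s` (letters = the starts lying in `s`, normalised along block `0` of `e₁`), their triple block
  sign `signOn` (`listSign` of the restricted block readings), and the value `val s`; `val 0 = 1`;
* §2 `val (2^D - 1) = normSum` (the full design: `listSign` of a full reading is `seqSignZ`);
* §3 diagonal masks (`IsDiagMask`: one position in every block of each structure) and the bridge
  `mem_allDiag_iff` to the letter-major stage-1 lists (all diagonals = `allDiag`);
* §4 **the expansion identity** `val_expand` (even number of blocks): for any position `c ∈ s`,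
  `val s = ∑_{d ∋ c, d ⊆ s diagonal} (-1)^{expo d s} · val (s ⊕ d)`, where `expo d s` is the total
  in-block rank of the positions of `d` among those of `s` — the letter class through `c` of a
  normalised Latin colouring is a diagonal mask (`isDiagMask_classMask`), restriction/extension
  (`latinOn_restrict`, `latinOn_extend`) is a bijection, and removing one entry from each of the
  `3b` block readings changes the sign by `(-1)^{expo}` (`listSign_append_cons`, `signOn_restrict`);
* §5 a **depth-first evaluator with a table of shared values** (`dfs`/`foldRow`, pivots supplied by
  an advice stream `pull`, Braun-indexed tables `BT`, per-diagonal sign lists `nlSpec` with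
  `sgnTab s (nlSpec d) = (-1)^{expo d s}`, table checks `tabCheck`, entry checks `checkEntries`) and
  its soundness `normSum_eq_of_checkEntries` (strong induction on the number of positions: every
  stored value whose key is a checked entry is the value of its key, `tabSound_of_checkEntries`);
* §6 the certificate interface `kronRect_pos_of_checkEntries`.

All kernel computations of a certificate are `decide`s of Boolean equations on literal tables;
nothing here is specific to `δ = 6`. Honest framing: a verified evaluator for a published
certificate type (BI 2013/2017 obstruction designs, AY 2022 Latin-cube signs); literature
bookkeeping for the cell `val-lit` (LADDER-VALIANT V3); nothing here bears on VP versus VNP.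

## References
* [BurgisserIkenmeyer2017] Thm. 5.9 (proof of (2)), Thm. 5.13 (proof), Prop. 5.22, Problem 5.19.
* [AmanovYeliussizov2022] Def. 7.4, Lemma 8.2, Lemma 8.3, Thm. 8.4, Cor. 8.5, Rem. 8.10.

## Mathlib and tree
Tree: `DesignLM.normSum`, `DesignLM.IsNormalised`, `DesignLM.kronRect_pos_of_normSum_ne_zero`,
`DesignLM.diagList`, `DesignLM.mem_diagList_iff`, `DesignLM.dpos`, `DesignLM.maskOf`, `DesignLM.pos`,
`DesignLM.BlockApart` (`KronRectDesignLetterMajor`); `DesignEnum.seqSignZ`, `DesignEnum.wordBlockSignZ`,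
`DesignEnum.tripleZ` (`KronRectDesignCertificates`); `Word` (`TensorWordModel`).
Mathlib: `Finset.sum_nbij'`, `Finset.sum_comm`, `Finset.sum_ite_eq`, `List.perm_ext_iff_of_nodup`,
`List.Perm.filter`, `List.perm_middle`, `List.pairwise_lt_finRange`, `List.sum_toFinset`,
`Finset.eq_of_subset_of_card_le`, `Nat.testBit_xor`, `Nat.testBit_land`, `Nat.eq_of_testBit_eq`,
`Fintype.sum_equiv`, `Finset.prod_pow_eq_pow_sum`, `Even.neg_one_pow`.

Provenance: val-lit cell, literature-prover val-lit-t04 g9 (2026-08-27).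
-/

open _root_.Literature.NumberTheory.DiophantineGeometry

namespace Literature.Computability.AlgebraicComplexity

namespace DesignDAG

variable {D b N : ℕ}

/-! ### §1 Sub-designs of a block-sign design: Latin colourings, their sign, the value `val` -/

/-- The sign of a sequence of naturals, `∏_{i<j} (+1 if lᵢ < lⱼ else -1)` — for a sequence of
pairwise distinct entries `(-1)^{#inversions}`. [folklore] -/
def listSign : List ℕ → ℤ
  | [] => 1
  | x :: l => (l.map fun y => if x < y then (1 : ℤ) else -1).prod * listSign l

/-- The reading of the word `u` along block `a` of the block structure `e`, restricted to the
position set (bit mask) `s`, in the order of the in-block index. [folklore] -/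
def blockList (e : Fin D ≃ Fin b × Fin N) (a : Fin b) (s : ℕ) (u : Word N D) : List ℕ :=
  ((List.finRange N).filter fun j => s.testBit (e.symm (a, j)).val).map fun j => (u (e.symm (a, j))).val

variable [NeZero b] [NeZero N]

/-- The letters of the sub-design `s`: the indices `a` whose START `e₁.symm (0, a)` (block `0` of
`e₁`) lies in `s` — in a normalised Latin colouring the letter class of `a` passes through its start.
[cite: AmanovYeliussizov2022, Thm. 8.4 (proof of (ii))] -/
def letters (e₁ : Fin D ≃ Fin b × Fin N) (s : ℕ) : List ℕ :=
  ((List.finRange N).filter fun a => s.testBit (e₁.symm (0, a)).val).map Fin.val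

/-- **Normalised Latin colourings of the sub-design `s`**: the word vanishes (letter `0`) off `s`,
reads a permutation of the letters of `s` along every block of each of the three structures
restricted to `s`, and is normalised (every start in `s` carries its own letter).
[cite: AmanovYeliussizov2022, Def. 7.4 and Thm. 8.4 (ii)] -/
def LatinOn (e₁ e₂ e₃ : Fin D ≃ Fin b × Fin N) (s : ℕ) (u : Word N D) : Prop :=
  (∀ p : Fin D, s.testBit p.val = false → u p = 0) ∧
  (∀ a : Fin b, (blockList e₁ a s u).Perm (letters e₁ s)) ∧
  (∀ a : Fin b, (blockList e₂ a s u).Perm (letters e₁ s)) ∧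
  (∀ a : Fin b, (blockList e₃ a s u).Perm (letters e₁ s)) ∧
  (∀ a : Fin N, s.testBit (e₁.symm (0, a)).val = true → u (e₁.symm (0, a)) = a)

omit [NeZero b] [NeZero N] in
/-- The triple block sign of a word on the sub-design `s`. [cite: BurgisserIkenmeyer2017, Thm. 5.9 (proof of (2))] -/
def signOn (e₁ e₂ e₃ : Fin D ≃ Fin b × Fin N) (s : ℕ) (u : Word N D) : ℤ :=
  (∏ a : Fin b, listSign (blockList e₁ a s u)) * (∏ a : Fin b, listSign (blockList e₂ a s u)) *
    (∏ a : Fin b, listSign (blockList e₃ a s u))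

open Classical in
/-- **The value of a sub-design**: the signed count of its normalised Latin colourings
(`AT₃` of the magic subset up to the letter quotient). [cite: AmanovYeliussizov2022, Thm. 8.4 (ii)] -/
noncomputable def val (e₁ e₂ e₃ : Fin D ≃ Fin b × Fin N) (s : ℕ) : ℤ :=
  ∑ u : Word N D, if LatinOn e₁ e₂ e₃ s u then signOn e₁ e₂ e₃ s u else 0

variable (e₁ e₂ e₃ : Fin D ≃ Fin b × Fin N)

/-- The empty sub-design has value `1` (only the zero word, empty readings).
[cite: AmanovYeliussizov2022, Thm. 8.4 (ii)] -/
theorem val_zero : val e₁ e₂ e₃ 0 = 1 := by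
  classical
  unfold val
  have hL : ∀ u : Word N D, LatinOn e₁ e₂ e₃ 0 u ↔ u = fun _ => 0 := by
    intro u
    constructor
    · intro h
      funext p
      exact h.1 p (Nat.zero_testBit p.val)
    · rintro rfl
      refine ⟨fun _ _ => rfl, ?_, ?_, ?_, fun a ha => ?_⟩
      · intro a; simp [blockList, letters]
      · intro a; simp [blockList, letters]
      · intro a; simp [blockList, letters]
      · simp at ha
  have hS : ∀ u : Word N D, signOn e₁ e₂ e₃ 0 u = 1 := by
    intro u; simp [signOn, blockList, listSign]
  simp_rw [hL, hS]
  rw [Finset.sum_ite_eq' Finset.univ (fun _ : Fin D => (0 : Fin N))]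
  simp

/-! ### §2 The full design: `val (2^D - 1) = normSum` -/

omit [NeZero b] [NeZero N] in
/-- `listSign` of a sequence given as a function: the product over pairs `i < j`. [folklore] -/
private theorem listSign_ofFn {n : ℕ} (f : Fin n → ℕ) :
    listSign (List.ofFn f) = ∏ i : Fin n, ∏ j : Fin n,
      if i < j then (if f i < f j then (1 : ℤ) else -1) else 1 := by
  induction n with
  | zero => simp [listSign]
  | succ n ih =>
    rw [List.ofFn_succ, listSign, ih, Fin.prod_univ_succ]
    congr 1
    · rw [Fin.prod_univ_succ, if_neg (lt_irrefl _), one_mul, List.map_ofFn, List.prod_ofFn]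
      refine Finset.prod_congr rfl fun j _ => ?_
      rw [if_pos (Fin.succ_pos j)]
      rfl
    · refine Finset.prod_congr rfl fun i _ => ?_
      rw [Fin.prod_univ_succ, if_neg (by simp), one_mul]
      refine Finset.prod_congr rfl fun j _ => ?_
      simp only [Fin.succ_lt_succ_iff]

omit [NeZero b] [NeZero N] in
/-- `listSign` of the full reading of a block equals the engine's `seqSignZ`. [folklore] -/
private theorem listSign_map_eq_seqSignZ (g : Fin N → Fin N) :
    listSign ((List.finRange N).map fun j => (g j).val) = DesignEnum.seqSignZ g := by
  rw [← List.ofFn_eq_map, listSign_ofFn, DesignEnum.seqSignZ]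
  refine Finset.prod_congr rfl fun p _ => Finset.prod_congr rfl fun p' _ => ?_
  simp only [Fin.lt_def]

omit [NeZero b] [NeZero N] in
/-- A reading is a permutation of `0,…,N-1` iff the block map is bijective. [folklore] -/
private theorem perm_map_val_iff_bijective (g : Fin N → Fin N) :
    ((List.finRange N).map fun j => (g j).val).Perm ((List.finRange N).map Fin.val) ↔
      Function.Bijective g := by
  have hnd : ((List.finRange N).map Fin.val).Nodup :=
    (List.nodup_finRange N).map Fin.val_injective
  constructor
  · intro h
    have h1 : ((List.finRange N).map fun j => (g j).val).Nodup := h.nodup_iff.2 hnd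
    have hinj : Function.Injective g := by
      intro x y hxy
      exact (List.nodup_map_iff_inj_on (List.nodup_finRange N)).1 h1 x (List.mem_finRange x) y
        (List.mem_finRange y) (congrArg Fin.val hxy)
    exact Finite.injective_iff_bijective.1 hinj
  · intro h
    apply (List.perm_ext_iff_of_nodup _ hnd).2
    · intro x
      simp only [List.mem_map, List.mem_finRange, true_and]
      constructor
      · rintro ⟨j, rfl⟩; exact ⟨g j, rfl⟩
      · rintro ⟨y, rfl⟩
        obtain ⟨j, hj⟩ := h.2 y
        exact ⟨j, by rw [hj]⟩
    · exact (List.nodup_map_iff_inj_on (List.nodup_finRange N)).2 fun x _ y _ hxy => h.1 (Fin.ext hxy)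

/-- The full mask has every position bit set (plumbing). [folklore] -/
private theorem testBit_full (p : Fin D) : (2 ^ D - 1).testBit p.val = true := by
  rw [Nat.testBit_two_pow_sub_one]; exact decide_eq_true p.isLt

omit [NeZero b] [NeZero N] in
/-- On the full mask the restricted reading is the whole block reading (plumbing). [folklore] -/
private theorem blockList_full (e : Fin D ≃ Fin b × Fin N) (a : Fin b) (u : Word N D) :
    blockList e a (2 ^ D - 1) u = (List.finRange N).map fun j => (u (e.symm (a, j))).val := by
  unfold blockList
  rw [List.filter_eq_self.2]
  intro j _
  exact testBit_full _

omit [NeZero N] in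
/-- The letters of the full design are all of `0,…,N-1` (plumbing). [folklore] -/
private theorem letters_full : letters e₁ (2 ^ D - 1) = (List.finRange N).map Fin.val := by
  unfold letters
  rw [List.filter_eq_self.2]
  intro j _
  exact testBit_full _

/-- **The value of the full design is the normalised signed count `normSum`** of the letter-major
file. [cite: AmanovYeliussizov2022, Thm. 8.4 (ii)] -/
theorem val_full : val e₁ e₂ e₃ (2 ^ D - 1) = DesignLM.normSum e₁ e₂ e₃ := by
  classical
  unfold val DesignLM.normSum
  refine Finset.sum_congr rfl fun u _ => ?_
  have hbij : ∀ e : Fin D ≃ Fin b × Fin N,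
      (∀ a : Fin b, (blockList e a (2 ^ D - 1) u).Perm (letters e₁ (2 ^ D - 1))) ↔
        ∀ a, Function.Bijective fun j => u (e.symm (a, j)) := by
    intro e
    refine forall_congr' fun a => ?_
    rw [blockList_full, letters_full, perm_map_val_iff_bijective]
  have hsign : ∀ e : Fin D ≃ Fin b × Fin N, (∀ a, Function.Bijective fun j => u (e.symm (a, j))) →
      (∏ a : Fin b, listSign (blockList e a (2 ^ D - 1) u)) = DesignEnum.wordBlockSignZ e u := by
    intro e he
    rw [DesignEnum.wordBlockSignZ, if_pos he]
    refine Finset.prod_congr rfl fun a _ => ?_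
    rw [blockList_full, listSign_map_eq_seqSignZ]
  by_cases hL : LatinOn e₁ e₂ e₃ (2 ^ D - 1) u
  · obtain ⟨-, h1, h2, h3, hn⟩ := id hL
    have hN : DesignLM.IsNormalised e₁ u := fun j => hn j (testBit_full _)
    rw [if_pos hL, if_pos hN, signOn, DesignEnum.tripleZ,
      hsign e₁ ((hbij e₁).1 h1), hsign e₂ ((hbij e₂).1 h2), hsign e₃ ((hbij e₃).1 h3)]
  · rw [if_neg hL]
    by_cases hN : DesignLM.IsNormalised e₁ u
    · rw [if_pos hN]
      -- some bijectivity fails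
      have : ¬ ((∀ a, Function.Bijective fun j => u (e₁.symm (a, j))) ∧
          (∀ a, Function.Bijective fun j => u (e₂.symm (a, j))) ∧
          (∀ a, Function.Bijective fun j => u (e₃.symm (a, j)))) := by
        rintro ⟨b1, b2, b3⟩
        exact hL ⟨fun p hp => absurd (testBit_full p) (by rw [hp]; decide),
          (hbij e₁).2 b1, (hbij e₂).2 b2, (hbij e₃).2 b3, fun a _ => hN a⟩
      simp only [not_and_or] at this
      unfold DesignEnum.tripleZ DesignEnum.wordBlockSignZ
      rcases this with h | h | h
      · rw [if_neg h]; simp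
      · rw [if_neg h]; simp
      · rw [if_neg h]; simp
    · rw [if_neg hN]


/-! ### §3 Bit masks, diagonal masks, and the bridge to the letter-major stage-1 lists -/

omit [NeZero b] [NeZero N] in
/-- Bits of `maskOf` (re-proved from the letter-major file, where it is private). [folklore] -/
private theorem testBit_maskOf (l : List (Fin D)) (n : ℕ) :
    (DesignLM.maskOf l).testBit n = true ↔ ∃ q ∈ l, q.val = n := by
  induction l with
  | nil => simp [DesignLM.maskOf]
  | cons q l ih =>
    rw [DesignLM.maskOf, Nat.testBit_lor, Bool.or_eq_true, ih, Nat.testBit_two_pow, decide_eq_true_eq]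
    constructor
    · rintro (h | ⟨q', hq', h⟩)
      · exact ⟨q, List.mem_cons_self, h⟩
      · exact ⟨q', List.mem_cons_of_mem _ hq', h⟩
    · rintro ⟨q', hq', h⟩
      rcases List.mem_cons.1 hq' with rfl | hq'
      · exact Or.inl h
      · exact Or.inr ⟨q', hq', h⟩

omit [NeZero b] [NeZero N] in
/-- Bits of `maskOf` at a position (plumbing). [folklore] -/
private theorem testBit_maskOf_val (l : List (Fin D)) (p : Fin D) :
    (DesignLM.maskOf l).testBit p.val = true ↔ p ∈ l := by
  rw [testBit_maskOf]
  constructor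
  · rintro ⟨q, hq, h⟩; rwa [← Fin.ext h]
  · intro h; exact ⟨p, h, rfl⟩

omit [NeZero b] [NeZero N] in
/-- `maskOf` has no bits at or above `D` (plumbing). [folklore] -/
private theorem testBit_maskOf_of_le (l : List (Fin D)) {n : ℕ} (hn : D ≤ n) :
    (DesignLM.maskOf l).testBit n = false := by
  rw [Bool.eq_false_iff, ne_eq, testBit_maskOf]
  rintro ⟨q, -, hq⟩
  exact absurd q.isLt (by omega)

/-- `d &&& s = d` iff the bits of `d` are bits of `s` (plumbing). [folklore] -/
private theorem land_eq_self_iff (d s : ℕ) : d &&& s = d ↔ ∀ n, d.testBit n = true → s.testBit n = true := by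
  constructor
  · intro h n hd
    have := congrArg (fun z => Nat.testBit z n) h
    simp only [Nat.testBit_land, hd, Bool.true_and] at this
    exact this
  · intro h
    apply Nat.eq_of_testBit_eq
    intro n
    rw [Nat.testBit_land]
    cases hd : d.testBit n
    · simp
    · simp [h n hd]

/-- Bits of `s ^^^ d` for `d ⊆ s` (plumbing). [folklore] -/
private theorem testBit_xor_of_subset {d s : ℕ} (h : d &&& s = d) (n : ℕ) :
    (s ^^^ d).testBit n = (s.testBit n && !d.testBit n) := by
  rw [Nat.testBit_xor]
  cases hd : d.testBit n
  · simp
  · have := (land_eq_self_iff d s).1 h n hd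
    simp [this]

/-- **One position in every block** of the structure `e`. [cite: AmanovYeliussizov2022, Def. 7.4] -/
def OnePerBlock (e : Fin D ≃ Fin b × Fin N) (d : ℕ) : Prop :=
  ∀ a : Fin b, ∃! j : Fin N, d.testBit (e.symm (a, j)).val = true

/-- **Diagonal masks**: bit masks below `2^D` with exactly one position in every block of each of the
three structures (a "diagonal" of the magic set / the letter class of a Latin colouring).
[cite: AmanovYeliussizov2022, Def. 7.4] -/
def IsDiagMask (d : ℕ) : Prop :=
  (∀ n, D ≤ n → d.testBit n = false) ∧ OnePerBlock e₁ d ∧ OnePerBlock e₂ d ∧ OnePerBlock e₃ d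

omit [NeZero b] [NeZero N] in
/-- The index of the position of `d` in block `a` of `e` (the first one found; meaningful under
`OnePerBlock`). [folklore] -/
def idxOf (e : Fin D ≃ Fin b × Fin N) (d : ℕ) (a : Fin b) : Fin N :=
  ((List.finRange N).find? fun j => d.testBit (e.symm (a, j)).val).getD 0

omit [NeZero b] in
/-- Under `OnePerBlock`, `idxOf` is the position of `d` in the block (plumbing). [folklore] -/
private theorem testBit_idxOf {e : Fin D ≃ Fin b × Fin N} {d : ℕ} (h : OnePerBlock e d) (a : Fin b) :
    d.testBit (e.symm (a, idxOf e d a)).val = true := by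
  obtain ⟨j, hj, -⟩ := h a
  unfold idxOf
  cases hf : (List.finRange N).find? fun j => d.testBit (e.symm (a, j)).val with
  | none =>
    rw [List.find?_eq_none] at hf
    exact absurd hj (by simpa using hf j (List.mem_finRange j))
  | some j' =>
    have := List.find?_some hf
    simpa using this

omit [NeZero b] in
/-- Under `OnePerBlock`, the position of `d` in a block is unique (plumbing). [folklore] -/
private theorem eq_idxOf {e : Fin D ≃ Fin b × Fin N} {d : ℕ} (h : OnePerBlock e d) {a : Fin b} {j : Fin N}
    (hj : d.testBit (e.symm (a, j)).val = true) : j = idxOf e d a :=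
  (h a).unique hj (testBit_idxOf h a)

omit [NeZero b] in
/-- Under `OnePerBlock`, a position of `d` is the `idxOf` of its own block (plumbing). [folklore] -/
private theorem eq_symm_idxOf {e : Fin D ≃ Fin b × Fin N} {d : ℕ} (h : OnePerBlock e d) {p : Fin D}
    (hp : d.testBit p.val = true) : p = e.symm ((e p).1, idxOf e d (e p).1) := by
  have h1 : p = e.symm ((e p).1, (e p).2) := by simp
  have h2 : d.testBit (e.symm ((e p).1, (e p).2)).val = true := by rwa [← h1]
  rw [← eq_idxOf h h2]; exact h1

/-- All diagonals of the design, listed by their start: the concatenation of the letter-major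
stage-1 lists. [cite: AmanovYeliussizov2022, Def. 7.4] -/
def allDiag : List ℕ := (List.finRange N).flatMap (DesignLM.diagList e₁ e₂ e₃)

omit [NeZero N] in
/-- `dpos` of a function-list, in closed form (plumbing). [folklore] -/
private theorem dpos_ofFn {n : ℕ} (g : Fin n → Fin N) :
    DesignLM.dpos e₁ (List.ofFn g) =
      List.ofFn fun k : Fin n => DesignLM.pos e₁ (Fin.ofNat b (n - k.val)) (g k) := by
  induction n with
  | zero => simp [DesignLM.dpos]
  | succ n ih =>
    rw [List.ofFn_succ, DesignLM.dpos, ih, List.ofFn_succ]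
    simp only [List.length_ofFn, Fin.val_zero, Nat.sub_zero, Fin.val_succ, Nat.succ_sub_succ]

omit [NeZero N] in
/-- `dpos` of any word, in closed form (plumbing). [folklore] -/
private theorem dpos_eq_ofFn (w : List (Fin N)) :
    DesignLM.dpos e₁ w =
      List.ofFn fun k : Fin w.length => DesignLM.pos e₁ (Fin.ofNat b (w.length - k.val)) (w.get k) := by
  induction w with
  | nil => simp [DesignLM.dpos]
  | cons x w ih =>
    rw [DesignLM.dpos, ih, List.ofFn_succ]
    simp only [List.length_cons, Fin.val_zero, Nat.sub_zero, List.get_cons_zero, Fin.val_succ,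
      Nat.succ_sub_succ, List.get_cons_succ']


omit [NeZero N] in
/-- `Fin.ofNat` is faithful below `b` (plumbing). [folklore] -/
private theorem fin_ofNat_eq {r : ℕ} (h : r < b) : (Fin.ofNat b r : Fin b) = ⟨r, h⟩ := by
  ext; simp [Nat.mod_eq_of_lt h]

omit [NeZero b] [NeZero N] in
/-- `BlockApart` is symmetric (plumbing). [folklore] -/
private theorem blockApart_symm {q q' : Fin D} (h : DesignLM.BlockApart e₂ e₃ q q') :
    DesignLM.BlockApart e₂ e₃ q' q := ⟨fun h' => h.1 h'.symm, fun h' => h.2 h'.symm⟩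

omit [NeZero b] [NeZero N] in
/-- A list of `b` positions with pairwise distinct `e`-blocks meets every `e`-block exactly once
(pigeonhole; plumbing). [folklore] -/
private theorem onePerBlock_of_pairwise (e : Fin D ≃ Fin b × Fin N) (L : List (Fin D)) (hlen : L.length = b)
    (hpw : L.Pairwise fun q q' => (e q).1 ≠ (e q').1) (d : ℕ)
    (hd : ∀ p : Fin D, d.testBit p.val = true ↔ p ∈ L) : OnePerBlock e d := by
  classical
  have hnd : L.Nodup := hpw.imp (fun h heq => h (by rw [heq]))
  haveI : Std.Symm (fun q q' : Fin D => (e q).1 ≠ (e q').1) := ⟨fun _ _ h => h.symm⟩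
  have hall : ∀ q ∈ L, ∀ q' ∈ L, q ≠ q' → (e q).1 ≠ (e q').1 :=
    fun q hq q' hq' hne => hpw.forall hq hq' hne
  -- the block map is injective on `L`, hence onto `Fin b`
  have himg : (L.toFinset.image fun q => (e q).1) = Finset.univ := by
    apply Finset.eq_univ_of_card
    rw [Finset.card_image_of_injOn, List.card_toFinset, List.Nodup.dedup hnd, hlen, Fintype.card_fin]
    intro q hq q' hq' heq
    by_contra hne
    exact hall q (by simpa using hq) q' (by simpa using hq') hne heq
  intro a
  have ha : a ∈ L.toFinset.image fun q => (e q).1 := by rw [himg]; exact Finset.mem_univ a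
  obtain ⟨q, hq, hqa⟩ := Finset.mem_image.1 ha
  rw [List.mem_toFinset] at hq
  refine ⟨(e q).2, ?_, ?_⟩
  · have : e.symm (a, (e q).2) = q := by rw [← hqa, Prod.mk.eta, Equiv.symm_apply_apply]
    beta_reduce; rw [this]; exact (hd q).2 hq
  · intro j hj
    have hmem := (hd _).1 hj
    by_contra hne
    have hne' : e.symm (a, j) ≠ q := by
      intro heq
      apply hne
      have := congrArg (fun x => (e x).2) heq
      simpa using this
    have := hall _ hmem q hq hne'
    rw [Equiv.apply_symm_apply] at this
    exact this hqa.symm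

/-- **The stage-1 lists of the letter-major file list exactly the diagonal masks.**
[cite: AmanovYeliussizov2022, Def. 7.4] -/
theorem mem_allDiag_iff (d : ℕ) : d ∈ allDiag e₁ e₂ e₃ ↔ IsDiagMask e₁ e₂ e₃ d := by
  classical
  have hb1 : b - 1 < b := Nat.sub_lt (Nat.pos_of_ne_zero (NeZero.ne b)) Nat.one_pos
  unfold allDiag
  rw [List.mem_flatMap]
  constructor
  · rintro ⟨a, -, hd⟩
    obtain ⟨w, hlen, hpw, rfl⟩ := (DesignLM.mem_diagList_iff e₁ e₂ e₃ a d).1 hd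
    set L := DesignLM.dpos e₁ w ++ [DesignLM.pos e₁ 0 a] with hL
    -- members of `L`, block by block for `e₁`
    have hmemL : ∀ q : Fin D, q ∈ L ↔
        (∃ k : Fin w.length, q = DesignLM.pos e₁ (Fin.ofNat b (w.length - k.val)) (w.get k)) ∨
          q = DesignLM.pos e₁ 0 a := by
      intro q
      rw [hL, List.mem_append, List.mem_singleton, dpos_eq_ofFn, List.mem_ofFn]
      simp only [eq_comm]
    have hbits : ∀ p : Fin D, (DesignLM.maskOf L).testBit p.val = true ↔ p ∈ L := testBit_maskOf_val L
    have hlenL : L.length = b := by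
      rw [hL, List.length_append, List.length_singleton, dpos_eq_ofFn, List.length_ofFn]; omega
    refine ⟨fun n hn => testBit_maskOf_of_le L hn, ?_, ?_, ?_⟩
    · -- `e₁`: block `0` holds the start, block `m ≥ 1` the entry `w.get (|w| - m)`
      intro a'
      by_cases ha' : a' = 0
      · subst ha'
        refine ⟨a, (hbits _).2 ((hmemL _).2 (Or.inr rfl)), fun j hj => ?_⟩
        rcases (hmemL _).1 ((hbits _).1 hj) with ⟨k, hk⟩ | hk
        · have := congrArg (fun q => (e₁ q).1) hk
          simp only [DesignLM.pos, Equiv.apply_symm_apply] at this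
          rw [fin_ofNat_eq (by omega)] at this
          have := congrArg Fin.val this
          simp only [Fin.val_zero] at this
          omega
        · have := congrArg (fun q => (e₁ q).2) hk
          simpa [DesignLM.pos] using this
      · have ha'1 : 1 ≤ a'.val := Nat.one_le_iff_ne_zero.2 fun h => ha' (Fin.ext h)
        have hlt : w.length - a'.val < w.length := by omega
        let k₀ : Fin w.length := ⟨w.length - a'.val, hlt⟩
        have hk₀ : (Fin.ofNat b (w.length - k₀.val) : Fin b) = a' := by
          rw [fin_ofNat_eq (by simp only [k₀]; omega)]; ext; simp only [k₀]; omega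
        refine ⟨w.get k₀, (hbits _).2 ((hmemL _).2 (Or.inl ⟨k₀, by rw [hk₀]⟩)), fun j hj => ?_⟩
        rcases (hmemL _).1 ((hbits _).1 hj) with ⟨k, hk'⟩ | hk'
        · have h1 := congrArg (fun q => (e₁ q).1) hk'
          have h2 := congrArg (fun q => (e₁ q).2) hk'
          simp only [DesignLM.pos, Equiv.apply_symm_apply] at h1 h2
          rw [fin_ofNat_eq (by omega)] at h1
          have hkv : k = k₀ := by
            have := congrArg Fin.val h1
            ext
            simp only [k₀] at this ⊢
            omega
          rw [h2, hkv]
        · have := congrArg (fun q => (e₁ q).1) hk'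
          simp only [DesignLM.pos, Equiv.apply_symm_apply] at this
          exact absurd this ha'
    · exact onePerBlock_of_pairwise e₂ L hlenL (hpw.imp fun h => h.1) _ hbits
    · exact onePerBlock_of_pairwise e₃ L hlenL (hpw.imp fun h => h.2) _ hbits
  · rintro ⟨hhi, h1, h2, h3⟩
    let a : Fin N := idxOf e₁ d 0
    let g : Fin (b - 1) → Fin N := fun k => idxOf e₁ d (Fin.ofNat b (b - 1 - k.val))
    refine ⟨a, List.mem_finRange a, (DesignLM.mem_diagList_iff e₁ e₂ e₃ a d).2 ⟨List.ofFn g, by simp, ?_⟩⟩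
    set L := DesignLM.dpos e₁ (List.ofFn g) ++ [DesignLM.pos e₁ 0 a] with hL
    -- members of `L` are exactly the positions of `d`
    have hmemL : ∀ q : Fin D, q ∈ L ↔ d.testBit q.val = true := by
      intro q
      rw [hL, List.mem_append, List.mem_singleton, dpos_ofFn, List.mem_ofFn]
      constructor
      · rintro (⟨k, rfl⟩ | rfl)
        · exact testBit_idxOf h1 _
        · exact testBit_idxOf h1 0
      · intro hq
        have hq' := eq_symm_idxOf h1 hq
        by_cases h0 : (e₁ q).1 = 0
        · right; rw [hq', h0]
        · left
          have hm1 : 1 ≤ (e₁ q).1.val := Nat.one_le_iff_ne_zero.2 fun h => h0 (Fin.ext h)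
          refine ⟨⟨b - 1 - (e₁ q).1.val, by omega⟩, ?_⟩
          have : (Fin.ofNat b (b - 1 - (b - 1 - (e₁ q).1.val)) : Fin b) = (e₁ q).1 := by
            rw [fin_ofNat_eq (by omega)]; ext; simp only; omega
          simp only [g, DesignLM.pos, this]
          exact hq'.symm
    have hnd : L.Nodup := by
      rw [hL, List.nodup_append]
      refine ⟨?_, List.nodup_singleton _, ?_⟩
      · rw [dpos_ofFn, List.nodup_ofFn]
        intro k k' hkk
        have := congrArg (fun q => (e₁ q).1.val) hkk
        simp only [DesignLM.pos, Equiv.apply_symm_apply] at this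
        rw [fin_ofNat_eq (by omega), fin_ofNat_eq (by omega)] at this
        ext; simp only at this; omega
      · intro q hq q' hq'
        rw [List.mem_singleton] at hq'
        subst hq'
        rw [dpos_ofFn, List.mem_ofFn] at hq
        obtain ⟨k, rfl⟩ := hq
        intro heq
        have := congrArg (fun q => (e₁ q).1.val) heq
        simp only [DesignLM.pos, Equiv.apply_symm_apply] at this
        rw [fin_ofNat_eq (by omega)] at this
        simp at this; omega
    constructor
    · refine hnd.pairwise_of_forall_ne fun q hq q' hq' hne => ⟨fun heq => hne ?_, fun heq => hne ?_⟩
      · have hq1 := eq_symm_idxOf h2 ((hmemL q).1 hq)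
        have hq2 := eq_symm_idxOf h2 ((hmemL q').1 hq')
        rw [hq1, hq2, heq]
      · have hq1 := eq_symm_idxOf h3 ((hmemL q).1 hq)
        have hq2 := eq_symm_idxOf h3 ((hmemL q').1 hq')
        rw [hq1, hq2, heq]
    · apply Nat.eq_of_testBit_eq
      intro n
      by_cases hn : n < D
      · have h := hmemL ⟨n, hn⟩
        rw [← testBit_maskOf_val] at h
        simp only at h
        cases h' : d.testBit n
        · cases h'' : (DesignLM.maskOf L).testBit n
          · rfl
          · exact absurd (h.1 h'') (by rw [h']; decide)
        · exact (h.2 h').symm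
      · rw [hhi n (by omega), testBit_maskOf_of_le L (by omega)]


/-! ### §4 The expansion identity along a pivot position -/

section Expansion

/-- The index list of block `a` of `e` restricted to `s` (plumbing). [folklore] -/
def idxList (e : Fin D ≃ Fin b × Fin N) (a : Fin b) (s : ℕ) : List (Fin N) :=
  (List.finRange N).filter fun j => s.testBit (e.symm (a, j)).val

omit [NeZero b] [NeZero N] in
/-- `blockList` is the index list read through the word (plumbing). [folklore] -/
private theorem blockList_eq_map (e : Fin D ≃ Fin b × Fin N) (a : Fin b) (s : ℕ) (u : Word N D) :
    blockList e a s u = (idxList e a s).map fun j => (u (e.symm (a, j))).val := rfl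

omit [NeZero b] [NeZero N] in
/-- The index list is strictly increasing (plumbing). [folklore] -/
private theorem pairwise_lt_idxList (e : Fin D ≃ Fin b × Fin N) (a : Fin b) (s : ℕ) :
    (idxList e a s).Pairwise (· < ·) :=
  (List.pairwise_lt_finRange N).filter _

omit [NeZero b] [NeZero N] in
/-- The index list has no duplicates (plumbing). [folklore] -/
private theorem nodup_idxList (e : Fin D ≃ Fin b × Fin N) (a : Fin b) (s : ℕ) : (idxList e a s).Nodup :=
  (List.nodup_finRange N).filter _

omit [NeZero b] [NeZero N] in
/-- Membership in the index list (plumbing). [folklore] -/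
private theorem mem_idxList (e : Fin D ≃ Fin b × Fin N) (a : Fin b) (s : ℕ) (j : Fin N) :
    j ∈ idxList e a s ↔ s.testBit (e.symm (a, j)).val = true := by
  simp [idxList]

omit [NeZero N] in
/-- The letters of `s` form a duplicate-free list (plumbing). [folklore] -/
private theorem nodup_letters (s : ℕ) : (letters e₁ s).Nodup :=
  ((List.nodup_finRange N).filter _).map Fin.val_injective

omit [NeZero N] in
/-- Membership in the letters of `s` (plumbing). [folklore] -/
private theorem mem_letters (s : ℕ) (x : ℕ) :
    x ∈ letters e₁ s ↔ ∃ a : Fin N, s.testBit (e₁.symm (0, a)).val = true ∧ a.val = x := by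
  simp [letters]

/-- **Positions of `s` before index `j` in block `a` of `e`** (the in-block rank used by the signs).
[folklore] -/
def before (e : Fin D ≃ Fin b × Fin N) (a : Fin b) (s : ℕ) (j : Fin N) : ℕ :=
  (Finset.univ.filter fun j' : Fin N => s.testBit (e.symm (a, j')).val = true ∧ j' < j).card

/-- **The sign exponent of removing the diagonal `d` from `s`**: the total in-block rank of the
positions of `d` among the positions of `s`, over all blocks of the three structures.
[cite: AmanovYeliussizov2022, Thm. 8.4 (proof of (ii))] -/
def expo (d s : ℕ) : ℕ :=
  (∑ a : Fin b, before e₁ a s (idxOf e₁ d a)) + (∑ a : Fin b, before e₂ a s (idxOf e₂ d a)) +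
    (∑ a : Fin b, before e₃ a s (idxOf e₃ d a))

/-! #### The sign of a sequence with one entry removed -/

omit [NeZero b] [NeZero N] in
/-- Head factor of `listSign` against a list avoiding the head value (plumbing). [folklore] -/
private theorem prod_map_sign_eq (x : ℕ) (B : List ℕ) (hB : ∀ y ∈ B, y ≠ x) :
    (B.map fun y => if x < y then (1 : ℤ) else -1).prod = (-1) ^ (B.filter (· < x)).length := by
  induction B with
  | nil => simp
  | cons y B ih =>
    have hy : y ≠ x := hB y List.mem_cons_self
    have ih' := ih fun z hz => hB z (List.mem_cons_of_mem _ hz)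
    rw [List.map_cons, List.prod_cons, ih', List.filter_cons]
    by_cases hxy : x < y
    · have : ¬ y < x := Nat.lt_asymm hxy
      simp [hxy, this]
    · have : y < x := lt_of_le_of_ne (Nat.le_of_not_lt hxy) hy
      simp [hxy, this, pow_succ]

omit [NeZero b] [NeZero N] in
/-- **Removing one entry from a sequence of distinct naturals** changes `listSign` by
`(-1)^{(its index) + (number of smaller entries)}`. [folklore] -/
private theorem listSign_append_cons (A B : List ℕ) (x : ℕ) (hAB : ∀ y ∈ A ++ B, y ≠ x) :
    listSign (A ++ x :: B) =
      (-1) ^ (A.length + ((A ++ B).filter (· < x)).length) * listSign (A ++ B) := by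
  induction A with
  | nil =>
    rw [List.nil_append, List.nil_append, listSign, List.length_nil, Nat.zero_add,
      prod_map_sign_eq x B (by simpa using hAB)]
  | cons z A ih =>
    have hz : z ≠ x := hAB z (by simp)
    have ih' := ih fun y hy => hAB y (by
      rw [List.cons_append]; exact List.mem_cons_of_mem _ hy)
    rw [List.cons_append, listSign, ih', List.cons_append, listSign, List.map_append, List.map_cons,
      List.prod_append, List.prod_cons, List.map_append, List.prod_append, List.length_cons,
      List.filter_cons]
    by_cases hzx : z < x
    · simp only [hzx, decide_true, if_true, List.length_cons]
      ring
    · have hxz : x < z := lt_of_le_of_ne (Nat.le_of_not_lt hzx) (Ne.symm hz)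
      simp only [hzx, decide_false, Bool.false_eq_true, if_false]
      ring

/-! #### Splitting the index list at the position of the diagonal -/

omit [NeZero b] [NeZero N] in
/-- A strictly increasing list splits at a member, with the smaller entries before it (plumbing).
[folklore] -/
private theorem split_of_mem_sorted {l : List (Fin N)} (hl : l.Pairwise (· < ·)) {j : Fin N} (hj : j ∈ l) :
    ∃ A B : List (Fin N), l = A ++ j :: B ∧ (∀ x ∈ A ++ B, x ≠ j) ∧
      l.filter (· ≠ j) = A ++ B ∧ (l.filter (· < j)).length = A.length := by
  obtain ⟨A, B, rfl⟩ := List.append_of_mem hj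
  rw [List.pairwise_append, List.pairwise_cons] at hl
  obtain ⟨hA, ⟨hjB, -⟩, hAB⟩ := hl
  have hA' : ∀ x ∈ A, x < j := fun x hx => hAB x hx j List.mem_cons_self
  refine ⟨A, B, rfl, ?_, ?_, ?_⟩
  · intro x hx
    rcases List.mem_append.1 hx with hx | hx
    · exact ne_of_lt (hA' x hx)
    · exact (ne_of_lt (hjB x hx)).symm
  · have h1 : A.filter (· ≠ j) = A := List.filter_eq_self.2 fun x hx => by simpa using ne_of_lt (hA' x hx)
    have h2 : B.filter (· ≠ j) = B :=
      List.filter_eq_self.2 fun x hx => by simpa using (ne_of_lt (hjB x hx)).symm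
    rw [List.filter_append, List.filter_cons, h1, h2]
    simp
  · have h1 : A.filter (· < j) = A := List.filter_eq_self.2 fun x hx => by simpa using hA' x hx
    have h2 : B.filter (· < j) = [] :=
      List.filter_eq_nil_iff.2 fun x hx => by simpa using Fin.le_of_lt (hjB x hx)
    rw [List.filter_append, List.filter_cons, h1, h2]
    simp

omit [NeZero b] [NeZero N] in
/-- The number of entries of the index list below `j` is `before` (plumbing). [folklore] -/
private theorem length_filter_lt_idxList (e : Fin D ≃ Fin b × Fin N) (a : Fin b) (s : ℕ) (j : Fin N) :
    ((idxList e a s).filter (· < j)).length = before e a s j := by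
  unfold idxList before
  rw [List.filter_filter, ← List.toFinset_card_of_nodup ((List.nodup_finRange N).filter _),
    List.toFinset_filter, List.toFinset_finRange]
  congr 1
  ext j'
  simp [and_comm]

/-! #### Diagonal masks inside `s`: the index list loses exactly one entry per block -/

omit [NeZero b] in
/-- For a mask `d ⊆ s` with one position per block of `e`, the index list of `s ^^^ d` is the index
list of `s` without the index of `d` (plumbing). [folklore] -/
private theorem idxList_xor {e : Fin D ≃ Fin b × Fin N} {d s : ℕ} (hd : OnePerBlock e d) (hds : d &&& s = d)
    (a : Fin b) : idxList e a (s ^^^ d) = (idxList e a s).filter (· ≠ idxOf e d a) := by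
  unfold idxList
  rw [List.filter_filter]
  apply List.filter_congr
  intro j _
  rw [testBit_xor_of_subset hds]
  by_cases h : j = idxOf e d a
  · subst h; simp [testBit_idxOf hd a]
  · have : d.testBit (e.symm (a, j)).val = false := by
      rw [Bool.eq_false_iff]; intro h'; exact h (eq_idxOf hd h')
    simp [this, h]

omit [NeZero b] in
/-- The index of `d` lies in the index list of `s` when `d ⊆ s` (plumbing). [folklore] -/
private theorem idxOf_mem_idxList {e : Fin D ≃ Fin b × Fin N} {d s : ℕ} (hd : OnePerBlock e d)
    (hds : d &&& s = d) (a : Fin b) : idxOf e d a ∈ idxList e a s :=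
  (mem_idxList e a s _).2 ((land_eq_self_iff d s).1 hds _ (testBit_idxOf hd a))

/-! #### Letter classes of a Latin colouring are diagonal masks -/

omit [NeZero b] [NeZero N] in
/-- A nodup list containing `x` is a permutation of `x ::` the rest (plumbing). [folklore] -/
private theorem perm_cons_filter_ne {l : List ℕ} (hl : l.Nodup) {x : ℕ} (hx : x ∈ l) :
    l.Perm (x :: l.filter (· ≠ x)) := by
  apply (List.perm_ext_iff_of_nodup hl _).2
  · intro y
    by_cases hy : y = x
    · subst hy; simp [hx]
    · simp [hy]
  · refine List.nodup_cons.2 ⟨by simp, hl.filter _⟩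

omit [NeZero b] [NeZero N] in
/-- Dropping the middle entry of a permutation of a nodup list (plumbing). [folklore] -/
private theorem perm_filter_of_perm_middle {L₁ L₂ M : List ℕ} {x : ℕ} (hM : M.Nodup)
    (h : (L₁ ++ x :: L₂).Perm M) :
    (L₁ ++ L₂).Perm (M.filter (· ≠ x)) ∧ (∀ y ∈ L₁ ++ L₂, y ≠ x) := by
  have hnd : (L₁ ++ x :: L₂).Nodup := h.nodup_iff.2 hM
  have hnd' : (x :: (L₁ ++ L₂)).Nodup := List.perm_middle.nodup_iff.1 hnd
  have hx : x ∉ L₁ ++ L₂ := (List.nodup_cons.1 hnd').1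
  have hne : ∀ y ∈ L₁ ++ L₂, y ≠ x := fun y hy heq => hx (heq ▸ hy)
  refine ⟨?_, hne⟩
  have h' := h.filter (· ≠ x)
  rw [List.filter_append, List.filter_cons] at h'
  have h1 : L₁.filter (· ≠ x) = L₁ :=
    List.filter_eq_self.2 fun y hy => by simpa using hne y (List.mem_append_left _ hy)
  have h2 : L₂.filter (· ≠ x) = L₂ :=
    List.filter_eq_self.2 fun y hy => by simpa using hne y (List.mem_append_right _ hy)
  rw [h1, h2] at h'
  simpa using h'

variable {e₁ e₂ e₃}

omit [NeZero b] [NeZero N] in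
/-- The value of a word at a position of `s` appears in the reading of its block (plumbing). [folklore] -/
private theorem val_mem_blockList (e : Fin D ≃ Fin b × Fin N) {s : ℕ} (u : Word N D) {p : Fin D}
    (hp : s.testBit p.val = true) : (u p).val ∈ blockList e (e p).1 s u := by
  have hp' : e.symm ((e p).1, (e p).2) = p := by rw [Prod.mk.eta, Equiv.symm_apply_apply]
  rw [blockList_eq_map, List.mem_map]
  exact ⟨(e p).2, (mem_idxList e _ s _).2 (by rw [hp']; exact hp), by rw [hp']⟩

/-- The letters carried by a Latin colouring on `s` are letters of `s` (plumbing). [folklore] -/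
private theorem val_mem_letters {s : ℕ} {u : Word N D} (hL : LatinOn e₁ e₂ e₃ s u) {p : Fin D}
    (hp : s.testBit p.val = true) : (u p).val ∈ letters e₁ s :=
  (hL.2.1 (e₁ p).1).mem_iff.1 (val_mem_blockList e₁ u hp)

/-- In a normalised Latin colouring, the start of every letter in use lies in `s` (plumbing).
[folklore] -/
private theorem testBit_start {s : ℕ} {u : Word N D} (hL : LatinOn e₁ e₂ e₃ s u) {p : Fin D}
    (hp : s.testBit p.val = true) : s.testBit (e₁.symm (0, u p)).val = true := by
  obtain ⟨a, ha, hav⟩ := (mem_letters e₁ s _).1 (val_mem_letters hL hp)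
  rw [← Fin.ext hav]; exact ha

/-- **The letter class** of `α` in the word `u` on `s`, as a bit mask. [folklore] -/
def classMask (s : ℕ) (u : Word N D) (α : Fin N) : ℕ :=
  DesignLM.maskOf ((List.finRange D).filter fun p => s.testBit p.val && decide (u p = α))

omit [NeZero b] [NeZero N] in
/-- Bits of the letter class (plumbing). [folklore] -/
private theorem testBit_classMask (s : ℕ) (u : Word N D) (α : Fin N) (p : Fin D) :
    (classMask s u α).testBit p.val = true ↔ s.testBit p.val = true ∧ u p = α := by
  rw [classMask, testBit_maskOf_val]
  simp

omit [NeZero b] [NeZero N] in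
/-- The letter class has no high bits (plumbing). [folklore] -/
private theorem testBit_classMask_of_le (s : ℕ) (u : Word N D) (α : Fin N) {n : ℕ} (hn : D ≤ n) :
    (classMask s u α).testBit n = false := testBit_maskOf_of_le _ hn

omit [NeZero b] [NeZero N] in
/-- The letter class lies inside `s` (plumbing). [folklore] -/
private theorem classMask_land (s : ℕ) (u : Word N D) (α : Fin N) : classMask s u α &&& s = classMask s u α := by
  rw [land_eq_self_iff]
  intro n hn
  by_cases hnD : n < D
  · exact ((testBit_classMask s u α ⟨n, hnD⟩).1 hn).1
  · rw [testBit_classMask_of_le s u α (by omega)] at hn; exact absurd hn (by decide)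

omit [NeZero N] in
/-- **Each letter in use has exactly one position in every block**: the letter class of a
normalised Latin colouring has one position per block of a structure along which the colouring
reads permutations of the letters. [cite: AmanovYeliussizov2022, Def. 7.4] -/
theorem onePerBlock_classMask {s : ℕ} {u : Word N D} (e : Fin D ≃ Fin b × Fin N)
    (hperm : ∀ a, (blockList e a s u).Perm (letters e₁ s)) {α : Fin N} (hα : α.val ∈ letters e₁ s) :
    OnePerBlock e (classMask s u α) := by
  intro a
  have hmem : α.val ∈ blockList e a s u := (hperm a).mem_iff.2 hα
  rw [blockList_eq_map, List.mem_map] at hmem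
  obtain ⟨j, hj, hjα⟩ := hmem
  refine ⟨j, (testBit_classMask s u α _).2 ⟨(mem_idxList e a s j).1 hj, Fin.ext hjα⟩, fun j' hj' => ?_⟩
  obtain ⟨hs', hu'⟩ := (testBit_classMask s u α _).1 hj'
  have hnd : (blockList e a s u).Nodup := (hperm a).nodup_iff.2 (nodup_letters e₁ s)
  rw [blockList_eq_map] at hnd
  exact (List.nodup_map_iff_inj_on (nodup_idxList e a s)).1 hnd j' ((mem_idxList e a s j').2 hs') j hj
    (by rw [hu', hjα])

/-- The letter class of a normalised Latin colouring through a position of `s` is a diagonal mask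
whose start carries its letter. [cite: AmanovYeliussizov2022, Def. 7.4] -/
theorem isDiagMask_classMask {s : ℕ} {u : Word N D} (hL : LatinOn e₁ e₂ e₃ s u) {c : Fin D}
    (hc : s.testBit c.val = true) :
    IsDiagMask e₁ e₂ e₃ (classMask s u (u c)) ∧ idxOf e₁ (classMask s u (u c)) 0 = u c := by
  have hα : (u c).val ∈ letters e₁ s := val_mem_letters hL hc
  have h1 : OnePerBlock e₁ (classMask s u (u c)) := onePerBlock_classMask e₁ hL.2.1 hα
  refine ⟨⟨fun n hn => testBit_classMask_of_le s u _ hn, h1, onePerBlock_classMask e₂ hL.2.2.1 hα,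
    onePerBlock_classMask e₃ hL.2.2.2.1 hα⟩, ?_⟩
  symm
  apply eq_idxOf h1
  rw [testBit_classMask]
  exact ⟨testBit_start hL hc, hL.2.2.2.2 _ (testBit_start hL hc)⟩

/-- The letters of `s` minus a diagonal mask `d ⊆ s`: the letter of `d` disappears.
[cite: AmanovYeliussizov2022, Thm. 8.4 (proof of (ii))] -/
theorem letters_xor {d s : ℕ} (hd : OnePerBlock e₁ d) (hds : d &&& s = d) :
    letters e₁ (s ^^^ d) = (letters e₁ s).filter (· ≠ (idxOf e₁ d 0).val) := by
  unfold letters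
  rw [List.filter_map, List.filter_filter]
  congr 1
  apply List.filter_congr
  intro a _
  rw [testBit_xor_of_subset hds]
  by_cases h : a = idxOf e₁ d 0
  · subst h; simp [testBit_idxOf hd 0]
  · have : d.testBit (e₁.symm (0, a)).val = false := by
      rw [Bool.eq_false_iff]; intro h'; exact h (eq_idxOf hd h')
    have h' : a.val ≠ (idxOf e₁ d 0).val := fun hh => h (Fin.ext hh)
    simp [this, h']

/-- Restriction of a word off a mask (letter `0` on the mask). [folklore] -/
def restrict (d : ℕ) (u : Word N D) : Word N D := fun p => if d.testBit p.val then 0 else u p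

omit [NeZero b] [NeZero N] in
/-- Extension of a word by a constant letter on a mask. [folklore] -/
def extend (d : ℕ) (α : Fin N) (u : Word N D) : Word N D := fun p => if d.testBit p.val then α else u p

omit [NeZero b] in
/-- The readings of a word that is constant `= α` on a diagonal mask `d ⊆ s`, and of a word agreeing
with it off `d`, along a block: split at the position of `d` (plumbing). [folklore] -/
private theorem blockList_split {e : Fin D ≃ Fin b × Fin N} {d s : ℕ} (hd : OnePerBlock e d) (hds : d &&& s = d)
    (a : Fin b) (u u' : Word N D) (α : Fin N) (hu : ∀ p : Fin D, d.testBit p.val = true → u p = α)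
    (huu' : ∀ p : Fin D, d.testBit p.val = false → u' p = u p) :
    ∃ A B : List ℕ, blockList e a s u = A ++ α.val :: B ∧ blockList e a (s ^^^ d) u' = A ++ B ∧
      A.length = before e a s (idxOf e d a) := by
  obtain ⟨A, B, hsplit, hne, hfilt, hlen⟩ :=
    split_of_mem_sorted (pairwise_lt_idxList e a s) (idxOf_mem_idxList hd hds a)
  let f : Fin N → ℕ := fun j => (u (e.symm (a, j))).val
  refine ⟨A.map f, B.map f, ?_, ?_, ?_⟩
  · rw [blockList_eq_map, hsplit, List.map_append, List.map_cons]
    simp only [f, hu _ (testBit_idxOf hd a)]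
  · rw [blockList_eq_map, idxList_xor hd hds, hfilt, ← List.map_append]
    apply List.map_congr_left
    intro j hj
    have : d.testBit (e.symm (a, j)).val = false := by
      rw [Bool.eq_false_iff]; intro h'; exact hne j hj (eq_idxOf hd h')
    simp only [f, huu' _ this]
  · rw [List.length_map, ← hlen, length_filter_lt_idxList]

omit [NeZero b] in
/-- **The sign of one block reading with the entry of `d` removed.** [folklore] -/
private theorem listSign_blockList_split {e : Fin D ≃ Fin b × Fin N} {d s : ℕ} (hd : OnePerBlock e d)
    (hds : d &&& s = d) (a : Fin b) (u u' : Word N D) (α : Fin N)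
    (hu : ∀ p : Fin D, d.testBit p.val = true → u p = α)
    (huu' : ∀ p : Fin D, d.testBit p.val = false → u' p = u p) {M : List ℕ} (hM : M.Nodup)
    (hperm : (blockList e a s u).Perm M) :
    listSign (blockList e a s u) = (-1) ^ (before e a s (idxOf e d a) +
        ((M.filter (· ≠ α.val)).filter (· < α.val)).length) * listSign (blockList e a (s ^^^ d) u') ∧
      (blockList e a (s ^^^ d) u').Perm (M.filter (· ≠ α.val)) := by
  obtain ⟨A, B, h1, h2, hlen⟩ := blockList_split hd hds a u u' α hu huu'
  rw [h1] at hperm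
  obtain ⟨hpermAB, hne⟩ := perm_filter_of_perm_middle hM hperm
  rw [h1, h2, listSign_append_cons A B α.val hne, hlen, (hpermAB.filter _).length_eq]
  exact ⟨rfl, hpermAB⟩

omit [NeZero b] in
/-- **The block signs of one structure with the diagonal removed**: product form of
`listSign_blockList_split` over all blocks. [folklore] -/
private theorem prod_listSign_split {e : Fin D ≃ Fin b × Fin N} {d s : ℕ} (hd : OnePerBlock e d)
    (hds : d &&& s = d) (u u' : Word N D) (α : Fin N)
    (hu : ∀ p : Fin D, d.testBit p.val = true → u p = α)
    (huu' : ∀ p : Fin D, d.testBit p.val = false → u' p = u p) {M : List ℕ} (hM : M.Nodup)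
    (hperm : ∀ a, (blockList e a s u).Perm M) :
    (∏ a, listSign (blockList e a s u)) = (-1) ^ ((∑ a, before e a s (idxOf e d a)) +
        b * ((M.filter (· ≠ α.val)).filter (· < α.val)).length) *
        ∏ a, listSign (blockList e a (s ^^^ d) u') ∧
      ∀ a, (blockList e a (s ^^^ d) u').Perm (M.filter (· ≠ α.val)) := by
  have h := fun a => listSign_blockList_split hd hds a u u' α hu huu' hM (hperm a)
  refine ⟨?_, fun a => (h a).2⟩
  rw [Finset.prod_congr rfl fun a _ => (h a).1, Finset.prod_mul_distrib, Finset.prod_pow_eq_pow_sum,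
    Finset.sum_add_distrib, Finset.sum_const, Finset.card_univ, Fintype.card_fin, smul_eq_mul]

/-- **Removing the letter class through the pivot**: the restricted word is a normalised Latin
colouring of the smaller sub-design. [cite: AmanovYeliussizov2022, Thm. 8.4 (proof of (ii))] -/
theorem latinOn_restrict {s : ℕ} {u : Word N D} (hL : LatinOn e₁ e₂ e₃ s u) {c : Fin D}
    (hc : s.testBit c.val = true) :
    LatinOn e₁ e₂ e₃ (s ^^^ classMask s u (u c)) (restrict (classMask s u (u c)) u) := by
  obtain ⟨⟨-, h1, h2, h3⟩, hidx⟩ := isDiagMask_classMask hL hc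
  set d := classMask s u (u c) with hd
  have hds : d &&& s = d := classMask_land s u _
  have hu : ∀ p : Fin D, d.testBit p.val = true → u p = u c := fun p hp =>
    ((testBit_classMask s u _ p).1 hp).2
  have huu' : ∀ p : Fin D, d.testBit p.val = false → restrict d u p = u p := fun p hp => by
    simp [restrict, hp]
  have hM := nodup_letters e₁ s
  have hlet : letters e₁ (s ^^^ d) = (letters e₁ s).filter (· ≠ (u c).val) := by
    rw [letters_xor h1 hds, hidx]
  refine ⟨fun p hp => ?_, fun a => ?_, fun a => ?_, fun a => ?_, fun a ha => ?_⟩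
  · rw [testBit_xor_of_subset hds] at hp
    unfold restrict
    by_cases hdp : d.testBit p.val = true
    · rw [if_pos hdp]
    · rw [if_neg hdp]
      apply hL.1
      simpa [hdp] using hp
  · rw [hlet]; exact (prod_listSign_split h1 hds u _ (u c) hu huu' hM hL.2.1).2 a
  · rw [hlet]; exact (prod_listSign_split h2 hds u _ (u c) hu huu' hM hL.2.2.1).2 a
  · rw [hlet]; exact (prod_listSign_split h3 hds u _ (u c) hu huu' hM hL.2.2.2.1).2 a
  · rw [testBit_xor_of_subset hds, Bool.and_eq_true, Bool.not_eq_true'] at ha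
    rw [huu' _ ha.2]
    exact hL.2.2.2.2 a ha.1

/-- **The sign of removing the letter class through the pivot** (even number of blocks): the
triple block sign changes by `(-1)^{expo}`. [cite: AmanovYeliussizov2022, Thm. 8.4 (proof of (ii))] -/
theorem signOn_restrict (hb : Even b) {s : ℕ} {u : Word N D} (hL : LatinOn e₁ e₂ e₃ s u) {c : Fin D}
    (hc : s.testBit c.val = true) :
    signOn e₁ e₂ e₃ s u = (-1) ^ expo e₁ e₂ e₃ (classMask s u (u c)) s *
      signOn e₁ e₂ e₃ (s ^^^ classMask s u (u c)) (restrict (classMask s u (u c)) u) := by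
  obtain ⟨⟨-, h1, h2, h3⟩, -⟩ := isDiagMask_classMask hL hc
  set d := classMask s u (u c) with hd
  have hds : d &&& s = d := classMask_land s u _
  have hu : ∀ p : Fin D, d.testBit p.val = true → u p = u c := fun p hp =>
    ((testBit_classMask s u _ p).1 hp).2
  have huu' : ∀ p : Fin D, d.testBit p.val = false → restrict d u p = u p := fun p hp => by
    simp [restrict, hp]
  have hM := nodup_letters e₁ s
  set K := (((letters e₁ s).filter (· ≠ (u c).val)).filter (· < (u c).val)).length with hK
  obtain ⟨hp1, -⟩ := prod_listSign_split h1 hds u (restrict d u) (u c) hu huu' hM hL.2.1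
  obtain ⟨hp2, -⟩ := prod_listSign_split h2 hds u (restrict d u) (u c) hu huu' hM hL.2.2.1
  obtain ⟨hp3, -⟩ := prod_listSign_split h3 hds u (restrict d u) (u c) hu huu' hM hL.2.2.2.1
  have heven : Even (3 * (b * K)) := (hb.mul_right K).mul_left 3
  unfold signOn
  rw [hp1, hp2, hp3, expo]
  rw [show ∀ x y z p q r : ℤ, (p * x) * (q * y) * (r * z) = (p * q * r) * (x * y * z) by intros; ring,
    ← pow_add, ← pow_add]
  congr 1
  rw [show ∀ n₁ n₂ n₃ : ℕ, (n₁ + b * K) + (n₂ + b * K) + (n₃ + b * K) = (n₁ + n₂ + n₃) + 3 * (b * K) by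
    intros; ring, pow_add, heven.neg_one_pow, mul_one]

/-- Restricting an extension recovers the word (plumbing). [folklore] -/
private theorem restrict_extend {d s : ℕ} (hds : d &&& s = d) {u' : Word N D}
    (hL' : LatinOn e₁ e₂ e₃ (s ^^^ d) u') (α : Fin N) : restrict d (extend d α u') = u' := by
  funext p
  simp only [restrict, extend]
  by_cases h : d.testBit p.val = true
  · rw [if_pos h]
    symm
    apply hL'.1
    rw [testBit_xor_of_subset hds, h]; simp
  · rw [if_neg h, if_neg h]

/-- Extending the restriction recovers the word (plumbing). [folklore] -/
private theorem extend_restrict {s : ℕ} {u : Word N D} (c : Fin D) :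
    extend (classMask s u (u c)) (u c) (restrict (classMask s u (u c)) u) = u := by
  funext p
  simp only [restrict, extend]
  by_cases h : (classMask s u (u c)).testBit p.val = true
  · rw [if_pos h]; exact ((testBit_classMask s u _ p).1 h).2.symm
  · rw [if_neg h, if_neg h]

/-- **Adding a diagonal mask back**: extending a normalised Latin colouring of `s ^^^ d` by the
letter of `d` on `d` gives a normalised Latin colouring of `s` whose letter class through any
position of `d` is `d`. [cite: AmanovYeliussizov2022, Thm. 8.4 (proof of (ii))] -/
theorem latinOn_extend {d s : ℕ} (hdm : IsDiagMask e₁ e₂ e₃ d) (hds : d &&& s = d)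
    {u' : Word N D} (hL' : LatinOn e₁ e₂ e₃ (s ^^^ d) u') :
    LatinOn e₁ e₂ e₃ s (extend d (idxOf e₁ d 0) u') ∧
      classMask s (extend d (idxOf e₁ d 0) u') (idxOf e₁ d 0) = d := by
  obtain ⟨hhi, h1, h2, h3⟩ := hdm
  set α := idxOf e₁ d 0 with hα
  set u := extend d α u' with hu_def
  have hu : ∀ p : Fin D, d.testBit p.val = true → u p = α := fun p hp => by simp [hu_def, extend, hp]
  have huu' : ∀ p : Fin D, d.testBit p.val = false → u' p = u p := fun p hp => by simp [hu_def, extend, hp]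
  have hstart : s.testBit (e₁.symm (0, α)).val = true :=
    (land_eq_self_iff d s).1 hds _ (testBit_idxOf h1 0)
  have hαmem : α.val ∈ letters e₁ s := (mem_letters e₁ s _).2 ⟨α, hstart, rfl⟩
  have hM := nodup_letters e₁ s
  have hlet : letters e₁ (s ^^^ d) = (letters e₁ s).filter (· ≠ α.val) := letters_xor h1 hds
  -- the block readings of `u` are permutations of the letters of `s`
  have hperm : ∀ (e : Fin D ≃ Fin b × Fin N), OnePerBlock e d →
      (∀ a, (blockList e a (s ^^^ d) u').Perm (letters e₁ (s ^^^ d))) →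
      ∀ a, (blockList e a s u).Perm (letters e₁ s) := by
    intro e he hp a
    obtain ⟨A, B, hA, hB, -⟩ := blockList_split he hds a u u' α hu huu'
    rw [hA]
    have hAB : (A ++ B).Perm ((letters e₁ s).filter (· ≠ α.val)) := by rw [← hB, ← hlet]; exact hp a
    exact (List.perm_middle.trans (hAB.cons α.val)).trans (perm_cons_filter_ne hM hαmem).symm
  have hL : LatinOn e₁ e₂ e₃ s u := by
    refine ⟨fun p hp => ?_, hperm e₁ h1 hL'.2.1, hperm e₂ h2 hL'.2.2.1, hperm e₃ h3 hL'.2.2.2.1,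
      fun a ha => ?_⟩
    · have hdp : d.testBit p.val = false := by
        rw [Bool.eq_false_iff]; intro h
        have := (land_eq_self_iff d s).1 hds _ h
        rw [hp] at this; exact Bool.noConfusion this
      rw [← huu' p hdp]
      apply hL'.1
      rw [testBit_xor_of_subset hds, hp]; simp
    · by_cases hda : d.testBit (e₁.symm (0, a)).val = true
      · rw [hu _ hda, eq_idxOf h1 hda]
      · rw [Bool.not_eq_true] at hda
        rw [← huu' _ hda]
        apply hL'.2.2.2.2
        rw [testBit_xor_of_subset hds, ha, hda]; simp
  refine ⟨hL, ?_⟩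
  apply Nat.eq_of_testBit_eq
  intro n
  by_cases hn : n < D
  · have key : (classMask s u α).testBit n = true ↔ d.testBit n = true := by
      rw [show n = (⟨n, hn⟩ : Fin D).val from rfl, testBit_classMask]
      constructor
      · rintro ⟨hs, hua⟩
        by_contra hdn
        rw [Bool.not_eq_true] at hdn
        have hsd : (s ^^^ d).testBit n = true := by
          rw [testBit_xor_of_subset hds, hdn]; simpa using hs
        have hmem := val_mem_letters hL' (p := ⟨n, hn⟩) hsd
        rw [hlet, List.mem_filter, huu' _ hdn, hua] at hmem
        simpa using hmem.2
      · intro hdn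
        exact ⟨(land_eq_self_iff d s).1 hds _ hdn, hu _ hdn⟩
    cases h1' : d.testBit n
    · rw [← Bool.not_eq_true, key, h1']; simp
    · exact key.2 h1'
  · rw [hhi n (by omega), testBit_classMask_of_le s u α (by omega)]

/-- **The expansion identity** (Laplace expansion of the signed count of normalised Latin
colourings along a pivot position; even number of blocks): the value of a sub-design `s` is the
signed sum, over the diagonal masks `d ⊆ s` through the pivot, of the values of `s ∖ d`.
[cite: AmanovYeliussizov2022, Thm. 8.4 (ii) and Cor. 8.5] -/
theorem val_expand (hb : Even b) (s : ℕ) {c : Fin D} (hc : s.testBit c.val = true) :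
    val e₁ e₂ e₃ s = ∑ d ∈ ((allDiag e₁ e₂ e₃).toFinset.filter
        fun d => d.testBit c.val = true ∧ d &&& s = d),
      (-1) ^ expo e₁ e₂ e₃ d s * val e₁ e₂ e₃ (s ^^^ d) := by
  classical
  set DS := ((allDiag e₁ e₂ e₃).toFinset.filter fun d => d.testBit c.val = true ∧ d &&& s = d)
    with hDS
  have step1 : ∀ u : Word N D, (if LatinOn e₁ e₂ e₃ s u then signOn e₁ e₂ e₃ s u else 0) =
      ∑ d ∈ DS, if LatinOn e₁ e₂ e₃ s u ∧ classMask s u (u c) = d then signOn e₁ e₂ e₃ s u else 0 := by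
    intro u
    by_cases hL : LatinOn e₁ e₂ e₃ s u
    · have hmem : classMask s u (u c) ∈ DS := by
        rw [hDS, Finset.mem_filter, List.mem_toFinset, mem_allDiag_iff]
        exact ⟨(isDiagMask_classMask hL hc).1, (testBit_classMask s u _ c).2 ⟨hc, rfl⟩,
          classMask_land s u _⟩
      simp only [hL, true_and, if_true]
      rw [Finset.sum_ite_eq DS (classMask s u (u c)), if_pos hmem]
    · simp [hL]
  have step3 : ∀ d ∈ DS, (∑ u : Word N D,
      if LatinOn e₁ e₂ e₃ s u ∧ classMask s u (u c) = d then signOn e₁ e₂ e₃ s u else 0) =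
      (-1) ^ expo e₁ e₂ e₃ d s * val e₁ e₂ e₃ (s ^^^ d) := by
    intro d hd
    rw [hDS, Finset.mem_filter, List.mem_toFinset, mem_allDiag_iff] at hd
    obtain ⟨hdm, hdc, hds⟩ := hd
    unfold val
    rw [← Finset.sum_filter, Finset.mul_sum]
    simp_rw [mul_ite, mul_zero]
    rw [← Finset.sum_filter]
    have hfix : ∀ u : Word N D, LatinOn e₁ e₂ e₃ s u ∧ classMask s u (u c) = d → idxOf e₁ d 0 = u c := by
      rintro u ⟨hL, hcl⟩
      rw [← hcl]; exact (isDiagMask_classMask hL hc).2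
    refine Finset.sum_nbij' (restrict d) (extend d (idxOf e₁ d 0)) ?_ ?_ ?_ ?_ ?_
    · intro u hu
      rw [Finset.mem_filter] at hu ⊢
      obtain ⟨-, hL, hcl⟩ := hu
      have := latinOn_restrict hL hc
      rw [hcl] at this
      exact ⟨Finset.mem_univ _, this⟩
    · intro u' hu'
      rw [Finset.mem_filter] at hu' ⊢
      obtain ⟨hL, hcl⟩ := latinOn_extend hdm hds hu'.2
      have hαc : extend d (idxOf e₁ d 0) u' c = idxOf e₁ d 0 := by simp [extend, hdc]
      refine ⟨Finset.mem_univ _, hL, ?_⟩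
      rw [hαc]; exact hcl
    · intro u hu
      rw [Finset.mem_filter] at hu
      obtain ⟨-, hL, hcl⟩ := hu
      rw [hfix u ⟨hL, hcl⟩, ← hcl]
      exact extend_restrict c
    · intro u' hu'
      rw [Finset.mem_filter] at hu'
      exact restrict_extend hds hu'.2 _
    · intro u hu
      rw [Finset.mem_filter] at hu
      obtain ⟨-, hL, hcl⟩ := hu
      have := signOn_restrict hb hL hc
      rw [hcl] at this
      exact this
  unfold val
  rw [Finset.sum_congr rfl fun u _ => step1 u, Finset.sum_comm]
  exact Finset.sum_congr rfl step3

end Expansion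


/-! ### §5 The memoised evaluator: tables, the advice stream, the depth-first run with a table of shared values -/

section Evaluator

/-- A Braun-indexed binary tree (random access tables for the kernel): index `0` at the root, odd
indices `i ↦ i / 2` on the left, even indices `i ≥ 2 ↦ i / 2 - 1` on the right.
[cite: Okasaki1997, §1 (Braun trees: element `i` of the left subtree is element `2i+1`)] -/
inductive BT (α : Type) where
  | nil : BT α
  | node : BT α → α → BT α → BT α

/-- Random access in a Braun-indexed tree. [cite: Okasaki1997, §1] -/
def BT.get? {α : Type} : BT α → ℕ → Option α
  | .nil, _ => none
  | .node l v r, i =>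
    cond (Nat.beq i 0) (some v)
      (cond (Nat.beq (i % 2) 1) (l.get? (i / 2)) (r.get? (i / 2 - 1)))

/-- A search tree of shared values keyed by state masks (the memo table of the certificate; no
ordering invariant is needed for soundness: `find` returns the value of SOME node with the given key).
[cite: CLRS2009, §12.1–§12.2 (binary search trees, TREE-SEARCH)] -/
inductive ST where
  | leaf : ST
  | node : ST → ℕ → ℤ → ST → ST

/-- Lookup in the table of shared values (TREE-SEARCH). [cite: CLRS2009, §12.2] -/
def ST.find : ST → ℕ → Option ℤ
  | .leaf, _ => none
  | .node l k v r, x =>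
    cond (Nat.beq x k) (some v) (cond (Nat.blt x k) (l.find x) (r.find x))

/-- The keys of the table, in order (INORDER-TREE-WALK). [cite: CLRS2009, §12.1] -/
def ST.keys : ST → List ℕ
  | .leaf => []
  | .node l k _ r => l.keys ++ k :: r.keys

omit [NeZero b] [NeZero N] in
/-- `Nat.beq` reflects equality (plumbing). [folklore] -/
private theorem natBeq_iff (a b : ℕ) : Nat.beq a b = true ↔ a = b :=
  ⟨Nat.eq_of_beq_eq_true, fun h => h ▸ Nat.beq_refl a⟩

omit [NeZero b] [NeZero N] in
/-- A successful lookup finds a key of the table (plumbing). [folklore] -/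
private theorem ST.mem_keys_of_find {t : ST} {x : ℕ} {v : ℤ} (h : t.find x = some v) : x ∈ t.keys := by
  induction t with
  | leaf => simp [ST.find] at h
  | node l k w r ihl ihr =>
    rw [ST.keys, List.mem_append, List.mem_cons]
    unfold ST.find at h
    cases hk : Nat.beq x k with
    | true => exact Or.inr (Or.inl ((natBeq_iff _ _).1 hk))
    | false =>
      rw [hk, cond_false] at h
      cases hb : Nat.blt x k with
      | true => rw [hb, cond_true] at h; exact Or.inl (ihl h)
      | false => rw [hb, cond_false] at h; exact Or.inr (Or.inr (ihr h))

omit [NeZero b] [NeZero N] in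
/-- **The sign factor of a table entry**: `(-1)^{#{q ∈ nl : q ∈ s}}` (direct recursor, for kernel
speed). [folklore] -/
def sgnTab (s : ℕ) (nl : List ℕ) : ℤ :=
  @List.rec ℕ (fun _ => ℤ) 1 (fun q _ ih => cond (s.testBit q) (-ih) ih) nl

omit [NeZero b] [NeZero N] in
/-- `sgnTab` unfolding (plumbing). [folklore] -/
private theorem sgnTab_cons (s q : ℕ) (l : List ℕ) :
    sgnTab s (q :: l) = cond (s.testBit q) (-sgnTab s l) (sgnTab s l) := rfl

/-- **The advice stream**: pivots packed base `128` (digit `= pivot + 1`, little-endian) into the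
naturals of a list; `pull` returns the next pivot and the remaining stream. [folklore] -/
def pull (cur : ℕ) (rest : List ℕ) : Option (ℕ × ℕ × List ℕ) :=
  cond (Nat.beq cur 0)
    (match rest with
      | [] => none
      | x :: rest' => cond (Nat.beq x 0) none (some (x % 128 - 1, x / 128, rest')))
    (some (cur % 128 - 1, cur / 128, rest))

/-- **Folding one table row** at state `S`: every diagonal `d ⊆ S` of the row contributes
`sign · value(S ⊕ d)`, the value being `1` for the empty state, the table value for a shared state,
and otherwise the value returned by the child evaluator `ev` (which consumes advice); the advice
stream is threaded through (direct recursor, for kernel speed). [folklore] -/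
def foldRow (dg : BT (ℕ × List ℕ)) (tab : ST) (ev : ℕ → ℕ → List ℕ → Option (ℤ × ℕ × List ℕ))
    (S : ℕ) (row : List (ℕ × ℕ)) : ℤ → ℕ → List ℕ → Option (ℤ × ℕ × List ℕ) :=
  @List.rec (ℕ × ℕ) (fun _ => ℤ → ℕ → List ℕ → Option (ℤ × ℕ × List ℕ))
    (fun acc cur rest => some (acc, cur, rest))
    (fun di _ ih acc cur rest =>
      cond (Nat.beq (Nat.land di.1 S) di.1)
        (cond (Nat.beq (Nat.xor S di.1) 0)
          (ih (acc + sgnTab S ((dg.get? di.2).getD (0, [])).2) cur rest)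
          (match tab.find (Nat.xor S di.1) with
            | some v => ih (acc + sgnTab S ((dg.get? di.2).getD (0, [])).2 * v) cur rest
            | none =>
              match ev (Nat.xor S di.1) cur rest with
              | none => none
              | some (v, cur', rest') =>
                ih (acc + sgnTab S ((dg.get? di.2).getD (0, [])).2 * v) cur' rest'))
        (ih acc cur rest))
    row

/-- **The depth-first evaluator** (fuelled by the depth): pull the pivot of the state from the advice
stream (it must be a position of the state, else fail) and fold its row. [folklore] -/
def dfs (Dn : ℕ) (rows : BT (List (ℕ × ℕ))) (dg : BT (ℕ × List ℕ)) (tab : ST) :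
    ℕ → ℕ → ℕ → List ℕ → Option (ℤ × ℕ × List ℕ)
  | 0, _, _, _ => none
  | fuel + 1, S, cur, rest =>
    match pull cur rest with
    | none => none
    | some (p, cur', rest') =>
      cond (Nat.blt p Dn && S.testBit p)
        (foldRow dg tab (dfs Dn rows dg tab fuel) S ((rows.get? p).getD []) 0 cur' rest') none

/-- **Checking one table entry**: the depth-first value of the key (with its own advice stream,
fuel `Dn`) is the table value. [folklore] -/
def checkEntry (Dn : ℕ) (rows : BT (List (ℕ × ℕ))) (dg : BT (ℕ × List ℕ)) (tab : ST)
    (e : ℕ × List ℕ) : Bool :=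
  match dfs Dn rows dg tab Dn e.1 0 e.2, tab.find e.1 with
  | some (v, _, _), some v' => decide (v = v')
  | _, _ => false

/-- **Checking a list of table entries.** [folklore] -/
def checkEntries (Dn : ℕ) (rows : BT (List (ℕ × ℕ))) (dg : BT (ℕ × List ℕ)) (tab : ST)
    (E : List (ℕ × List ℕ)) : Bool :=
  E.all (checkEntry Dn rows dg tab)

omit [NeZero b] [NeZero N] in
/-- Entry checks of a concatenation (so that certificate files can check chunks separately).
[folklore] -/
private theorem checkEntries_append (Dn : ℕ) (rows : BT (List (ℕ × ℕ))) (dg : BT (ℕ × List ℕ)) (tab : ST)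
    (E₁ E₂ : List (ℕ × List ℕ)) :
    checkEntries Dn rows dg tab (E₁ ++ E₂) =
      (checkEntries Dn rows dg tab E₁ && checkEntries Dn rows dg tab E₂) := by
  simp [checkEntries, List.all_append]

/-! #### The tables expected by the evaluator -/

/-- The parity count of a position against a diagonal mask: in how many of the three structures
the position precedes the position of `d` in its block. [folklore] -/
def mcount (d : ℕ) (q : Fin D) : ℕ :=
  (if (e₁ q).2 < idxOf e₁ d (e₁ q).1 then 1 else 0) + (if (e₂ q).2 < idxOf e₂ d (e₂ q).1 then 1 else 0) +
    (if (e₃ q).2 < idxOf e₃ d (e₃ q).1 then 1 else 0)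

/-- **The sign list of a diagonal mask**: the positions of odd parity count (so that
`(-1)^{expo d s} = sgnTab s (nlSpec d)`). [folklore] -/
def nlSpec (d : ℕ) : List ℕ :=
  ((List.finRange D).filter fun q => mcount e₁ e₂ e₃ d q % 2 = 1).map Fin.val

/-- The sign list with the block indices of `d` computed once per structure (what certificate files
evaluate). [folklore] -/
def nlFast (d : ℕ) : List ℕ :=
  let I₁ := List.ofFn (idxOf e₁ d)
  let I₂ := List.ofFn (idxOf e₂ d)
  let I₃ := List.ofFn (idxOf e₃ d)
  ((List.finRange D).filter fun q =>
    ((if (e₁ q).2 < I₁.getD (e₁ q).1.val 0 then 1 else 0) +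
      (if (e₂ q).2 < I₂.getD (e₂ q).1.val 0 then 1 else 0) +
      (if (e₃ q).2 < I₃.getD (e₃ q).1.val 0 then 1 else 0)) % 2 = 1).map Fin.val

omit [NeZero b] in
/-- `nlFast = nlSpec` (plumbing). [folklore] -/
private theorem nlFast_eq (d : ℕ) : nlFast e₁ e₂ e₃ d = nlSpec e₁ e₂ e₃ d := by
  have h : ∀ (e : Fin D ≃ Fin b × Fin N) (a : Fin b),
      (List.ofFn (idxOf e d)).getD a.val 0 = idxOf e d a := by
    intro e a
    rw [List.getD_eq_getElem?_getD, List.getElem?_ofFn]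
    simp [a.isLt]
  unfold nlFast nlSpec mcount
  simp only [h]

/-- **Row correctness**: the row of position `p` lists, without repetition, exactly the diagonals
of the reference list `AD` through `p`, each paired with (an index of) its sign list — the candidate
letter classes through `p`. [cite: AmanovYeliussizov2022, Def. 7.4] -/
def RowOK (AD : List ℕ) (dg : BT (ℕ × List ℕ)) (p : Fin D) (row : List (ℕ × ℕ)) : Prop :=
  (row.map Prod.fst).Nodup ∧
  (∀ di ∈ row, di.1.testBit p.val = true ∧ di.1 ∈ AD ∧
    ((dg.get? di.2).getD (0, [])).2 = nlSpec e₁ e₂ e₃ di.1) ∧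
  (∀ d ∈ AD, d.testBit p.val = true → d ∈ row.map Prod.fst)

/-- **Table correctness**: every position has a correct row. [cite: AmanovYeliussizov2022, Def. 7.4] -/
def TabOK (AD : List ℕ) (rows : BT (List (ℕ × ℕ))) (dg : BT (ℕ × List ℕ)) : Prop :=
  ∀ p : Fin D, RowOK e₁ e₂ e₃ AD dg p ((rows.get? p.val).getD [])

/-- Boolean check of the diagonal table: `AD` has no repetition and entry `i < nd` of `dg` is a
diagonal of `AD` with its sign list. [folklore] -/
def dgCheck (AD : List ℕ) (dg : BT (ℕ × List ℕ)) (nd : ℕ) : Bool :=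
  decide AD.Nodup && (List.range nd).all fun i =>
    match dg.get? i with
    | none => false
    | some dn => decide (dn.1 ∈ AD) && decide (dn.2 = nlFast e₁ e₂ e₃ dn.1)

/-- Boolean row check: keys without repetition, every entry a bit-`p` diagonal pointing at its own
`dg` entry below `nd`, and as many entries as `AD` has diagonals through `p`. [folklore] -/
def rowCheck (AD : List ℕ) (dg : BT (ℕ × List ℕ)) (nd p : ℕ) (row : List (ℕ × ℕ)) : Bool :=
  decide ((row.map Prod.fst).Nodup) &&
    (row.all fun di => Nat.blt di.2 nd && di.1.testBit p &&
      match dg.get? di.2 with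
      | none => false
      | some dn => Nat.beq di.1 dn.1) &&
    Nat.beq row.length (AD.countP fun d => d.testBit p)

/-- Boolean table check (what certificate files evaluate). [folklore] -/
def tabCheck (AD : List ℕ) (rows : BT (List (ℕ × ℕ))) (dg : BT (ℕ × List ℕ)) (nd : ℕ) : Bool :=
  dgCheck e₁ e₂ e₃ AD dg nd &&
    (List.range D).all fun p => rowCheck AD dg nd p ((rows.get? p).getD [])

omit [NeZero b] in
/-- A passing row check gives a correct row (plumbing). [folklore] -/
private theorem rowOK_of_rowCheck {AD : List ℕ} {dg : BT (ℕ × List ℕ)} {nd : ℕ} {p : Fin D}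
    {row : List (ℕ × ℕ)} (hdg : dgCheck e₁ e₂ e₃ AD dg nd = true)
    (h : rowCheck AD dg nd p.val row = true) : RowOK e₁ e₂ e₃ AD dg p row := by
  classical
  unfold dgCheck at hdg
  unfold rowCheck at h
  simp only [Bool.and_eq_true, decide_eq_true_eq, List.all_eq_true, List.mem_range] at hdg h
  obtain ⟨hADnd, hdg⟩ := hdg
  obtain ⟨⟨hnd, hall⟩, hlen⟩ := h
  rw [natBeq_iff] at hlen
  have hent : ∀ di ∈ row, di.1.testBit p.val = true ∧ di.1 ∈ AD ∧
      ((dg.get? di.2).getD (0, [])).2 = nlSpec e₁ e₂ e₃ di.1 := by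
    intro di hdi
    obtain ⟨⟨hi, hp⟩, hget⟩ := hall di hdi
    rw [Nat.blt_eq] at hi
    have hdgi := hdg di.2 hi
    cases hg : dg.get? di.2 with
    | none => rw [hg] at hget; exact absurd hget (by simp)
    | some dn =>
      rw [hg] at hget hdgi
      simp only [Bool.and_eq_true, decide_eq_true_eq] at hdgi
      have heq : di.1 = dn.1 := (natBeq_iff _ _).1 hget
      refine ⟨hp, heq ▸ hdgi.1, ?_⟩
      simp only [Option.getD_some]
      rw [hdgi.2, nlFast_eq, heq]
  refine ⟨hnd, hent, fun d hd hdp => ?_⟩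
  have hsub : (row.map Prod.fst).toFinset ⊆ (AD.filter fun d => d.testBit p.val).toFinset := by
    intro d hd'
    rw [List.mem_toFinset, List.mem_map] at hd'
    obtain ⟨di, hdi, rfl⟩ := hd'
    rw [List.mem_toFinset, List.mem_filter]
    exact ⟨(hent di hdi).2.1, (hent di hdi).1⟩
  have hcard : (AD.filter fun d => d.testBit p.val).toFinset.card ≤ (row.map Prod.fst).toFinset.card := by
    rw [List.toFinset_card_of_nodup hnd, List.toFinset_card_of_nodup (hADnd.filter _), List.length_map,
      hlen, List.countP_eq_length_filter]
  have heq := Finset.eq_of_subset_of_card_le hsub hcard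
  have : d ∈ (AD.filter fun d => d.testBit p.val).toFinset := by
    rw [List.mem_toFinset, List.mem_filter]; exact ⟨hd, hdp⟩
  rw [← heq, List.mem_toFinset] at this
  exact this

omit [NeZero b] in
/-- **A passing table check gives correct tables.** [folklore] -/
private theorem tabOK_of_tabCheck {AD : List ℕ} {rows : BT (List (ℕ × ℕ))} {dg : BT (ℕ × List ℕ)} {nd : ℕ}
    (h : tabCheck e₁ e₂ e₃ AD rows dg nd = true) : TabOK e₁ e₂ e₃ AD rows dg := by
  intro p
  unfold tabCheck at h
  rw [Bool.and_eq_true, List.all_eq_true] at h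
  exact rowOK_of_rowCheck e₁ e₂ e₃ h.1 (h.2 p.val (List.mem_range.2 p.isLt))

/-! #### Soundness of the evaluator -/

omit [NeZero b] [NeZero N] in
/-- `(-1)^n` by parity (plumbing). [folklore] -/
private theorem neg_one_pow_eq_ite (n : ℕ) : (-1 : ℤ) ^ n = if n % 2 = 1 then -1 else 1 := by
  rcases Nat.even_or_odd n with h | h
  · rw [h.neg_one_pow, if_neg (by rw [Nat.even_iff] at h; omega)]
  · rw [h.neg_one_pow, if_pos (Nat.odd_iff.1 h)]

omit [NeZero b] [NeZero N] in
/-- `sgnTab` as a product (plumbing). [folklore] -/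
private theorem sgnTab_eq_prod (s : ℕ) (l : List ℕ) :
    sgnTab s l = (l.map fun q => if s.testBit q = true then (-1 : ℤ) else 1).prod := by
  induction l with
  | nil => rfl
  | cons q l ih =>
    rw [sgnTab_cons, ih, List.map_cons, List.prod_cons]
    cases s.testBit q <;> simp

omit [NeZero b] in
/-- The block-wise rank sum of one structure as a sum over positions (plumbing). [folklore] -/
private theorem sum_before_eq (e : Fin D ≃ Fin b × Fin N) (d s : ℕ) :
    (∑ a : Fin b, before e a s (idxOf e d a)) =
      ∑ q : Fin D, if s.testBit q.val = true ∧ (e q).2 < idxOf e d (e q).1 then 1 else 0 := by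
  classical
  unfold before
  simp_rw [Finset.card_filter]
  rw [← Fintype.sum_prod_type']
  exact (Fintype.sum_equiv e _ _ fun q => by simp).symm

omit [NeZero b] in
/-- **The table sign is the expansion sign**: `sgnTab s (nlSpec d) = (-1)^{expo d s}`. [folklore] -/
private theorem sgnTab_nlSpec (d s : ℕ) :
    sgnTab s (nlSpec e₁ e₂ e₃ d) = (-1) ^ expo e₁ e₂ e₃ d s := by
  classical
  rw [sgnTab_eq_prod, nlSpec, List.map_map, ← List.prod_toFinset _ ((List.nodup_finRange D).filter _),
    List.toFinset_filter, List.toFinset_finRange, Finset.prod_filter]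
  rw [expo, sum_before_eq, sum_before_eq, sum_before_eq, ← Finset.sum_add_distrib,
    ← Finset.sum_add_distrib, ← Finset.prod_pow_eq_pow_sum]
  refine Finset.prod_congr rfl fun q _ => ?_
  simp only [Function.comp_apply]
  by_cases hs : s.testBit q.val = true
  · rw [neg_one_pow_eq_ite, mcount]
    simp only [hs, true_and, decide_eq_true_eq, if_true]
  · simp [hs]

/-- The number of positions (below `D`) of a mask: the termination measure. [folklore] -/
noncomputable def bitCard (x : ℕ) : ℕ := (Finset.univ.filter fun p : Fin D => x.testBit p.val = true).card

/-- Removing a nonempty sub-mask lowers the measure (plumbing). [folklore] -/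
private theorem bitCard_xor_lt {d S : ℕ} (hds : d &&& S = d) {p : Fin D} (hp : d.testBit p.val = true) :
    bitCard (D := D) (S ^^^ d) < bitCard (D := D) S := by
  classical
  unfold bitCard
  apply Finset.card_lt_card
  rw [Finset.ssubset_iff_subset_ne]
  constructor
  · intro q hq
    rw [Finset.mem_filter] at hq ⊢
    rw [testBit_xor_of_subset hds] at hq
    refine ⟨hq.1, ?_⟩
    revert hq; cases S.testBit q.val <;> simp
  · intro heq
    have : p ∈ Finset.univ.filter fun q : Fin D => S.testBit q.val = true :=
      Finset.mem_filter.2 ⟨Finset.mem_univ _, (land_eq_self_iff d S).1 hds _ hp⟩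
    rw [← heq, Finset.mem_filter, testBit_xor_of_subset hds, hp] at this
    simpa using this.2

variable {e₁ e₂ e₃}

/-- Table soundness below a measure: every stored value of a key with fewer than `n` positions is
the value of the key. [folklore] -/
private def TabSoundBelow (tab : ST) (n : ℕ) : Prop :=
  ∀ k v, bitCard (D := D) k < n → tab.find k = some v → val e₁ e₂ e₃ k = v

/-- Evaluator soundness below a measure. [folklore] -/
private def EvSoundBelow (ev : ℕ → ℕ → List ℕ → Option (ℤ × ℕ × List ℕ)) (n : ℕ) : Prop :=
  ∀ k cur rest v cur' rest', bitCard (D := D) k < n → ev k cur rest = some (v, cur', rest') →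
    val e₁ e₂ e₃ k = v

/-- **Folding a correct row computes the expansion sum** (given sound values for the children).
[folklore] -/
private theorem foldRow_sound {dg : BT (ℕ × List ℕ)} {tab : ST}
    {ev : ℕ → ℕ → List ℕ → Option (ℤ × ℕ × List ℕ)} {S : ℕ} {p : Fin D}
    (htab : TabSoundBelow (D := D) (e₁ := e₁) (e₂ := e₂) (e₃ := e₃) tab (bitCard (D := D) S))
    (hev : EvSoundBelow (D := D) (e₁ := e₁) (e₂ := e₂) (e₃ := e₃) ev (bitCard (D := D) S)) :
    ∀ (row : List (ℕ × ℕ)), (∀ di ∈ row, di.1.testBit p.val = true ∧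
        ((dg.get? di.2).getD (0, [])).2 = nlSpec e₁ e₂ e₃ di.1) →
      ∀ (acc : ℤ) (cur : ℕ) (rest : List ℕ) (acc' : ℤ) (cur' : ℕ) (rest' : List ℕ),
      foldRow dg tab ev S row acc cur rest = some (acc', cur', rest') →
      acc' = acc + ((row.filter fun di => di.1 &&& S = di.1).map
        fun di => (-1) ^ expo e₁ e₂ e₃ di.1 S * val e₁ e₂ e₃ (S ^^^ di.1)).sum := by
  intro row hrow
  induction row with
  | nil =>
    intro acc cur rest acc' cur' rest' h
    change some (acc, cur, rest) = some (acc', cur', rest') at h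
    simp only [Option.some.injEq, Prod.mk.injEq] at h
    simp [← h.1]
  | cons di row ih =>
    intro acc cur rest acc' cur' rest' h
    have hdi := hrow di List.mem_cons_self
    have ih' := ih fun x hx => hrow x (List.mem_cons_of_mem _ hx)
    have hsg : sgnTab S ((dg.get? di.2).getD (0, [])).2 = (-1) ^ expo e₁ e₂ e₃ di.1 S := by
      rw [hdi.2, sgnTab_nlSpec]
    change cond (Nat.beq (Nat.land di.1 S) di.1) _ (foldRow dg tab ev S row acc cur rest) = _ at h
    rw [List.filter_cons]
    by_cases hsub : di.1 &&& S = di.1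
    · have hb : Nat.beq (Nat.land di.1 S) di.1 = true := (natBeq_iff _ _).2 hsub
      rw [hb, cond_true] at h
      simp only [hsub, decide_true, if_true, List.map_cons, List.sum_cons]
      have hlt : bitCard (D := D) (S ^^^ di.1) < bitCard (D := D) S := bitCard_xor_lt hsub hdi.1
      by_cases h0 : S ^^^ di.1 = 0
      · have hb0 : Nat.beq (Nat.xor S di.1) 0 = true := (natBeq_iff _ _).2 h0
        rw [hb0, cond_true] at h
        rw [ih' _ _ _ _ _ _ h, hsg, h0, val_zero]; ring
      · have hb0 : Nat.beq (Nat.xor S di.1) 0 = false := by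
          rw [Bool.eq_false_iff, ne_eq, natBeq_iff]; exact h0
        rw [hb0, cond_false] at h
        change (match tab.find (S ^^^ di.1) with
          | some v => foldRow dg tab ev S row (acc + sgnTab S ((dg.get? di.2).getD (0, [])).2 * v) cur rest
          | none => match ev (S ^^^ di.1) cur rest with
            | none => none
            | some (v, cur', rest') =>
              foldRow dg tab ev S row (acc + sgnTab S ((dg.get? di.2).getD (0, [])).2 * v) cur' rest') =
          some (acc', cur', rest') at h
        cases hf : tab.find (S ^^^ di.1) with
        | some v =>
          rw [hf] at h
          simp only at h
          rw [ih' _ _ _ _ _ _ h, hsg, htab _ _ hlt hf]; ring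
        | none =>
          rw [hf] at h
          simp only at h
          cases he : ev (S ^^^ di.1) cur rest with
          | none => rw [he] at h; exact absurd h (by simp)
          | some vcr =>
            obtain ⟨v, cur₁, rest₁⟩ := vcr
            rw [he] at h
            simp only at h
            rw [ih' _ _ _ _ _ _ h, hsg, hev _ _ _ _ _ _ hlt he]; ring
    · have hb : Nat.beq (Nat.land di.1 S) di.1 = false := by
        rw [Bool.eq_false_iff, ne_eq, natBeq_iff]; exact hsub
      rw [hb, cond_false] at h
      simp only [hsub, decide_false, Bool.false_eq_true, if_false]
      exact ih' _ _ _ _ _ _ h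

/-- **Soundness of the depth-first evaluator**: with correct tables and sound shared values below
the state, a successful evaluation returns the value of the state.
[cite: AmanovYeliussizov2022, Thm. 8.4 (ii) and Cor. 8.5] -/
private theorem dfs_sound (hb : Even b) {AD : List ℕ} (hAD : AD.Perm (allDiag e₁ e₂ e₃))
    {rows : BT (List (ℕ × ℕ))} {dg : BT (ℕ × List ℕ)} (hT : TabOK e₁ e₂ e₃ AD rows dg) (tab : ST) :
    ∀ (fuel : ℕ) (S : ℕ) (cur : ℕ) (rest : List ℕ) (v : ℤ) (cur' : ℕ) (rest' : List ℕ),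
      TabSoundBelow (D := D) (e₁ := e₁) (e₂ := e₂) (e₃ := e₃) tab (bitCard (D := D) S) →
      dfs D rows dg tab fuel S cur rest = some (v, cur', rest') → val e₁ e₂ e₃ S = v := by
  classical
  intro fuel
  induction fuel with
  | zero => intro S cur rest v cur' rest' _ h; simp [dfs] at h
  | succ fuel ih =>
    intro S cur rest v cur' rest' htab h
    simp only [dfs] at h
    cases hp : pull cur rest with
    | none => rw [hp] at h; exact absurd h (by simp)
    | some pcr =>
      obtain ⟨p, cur₁, rest₁⟩ := pcr
      rw [hp] at h
      simp only at h
      cases hc : (Nat.blt p D && S.testBit p) with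
      | false => rw [hc] at h; exact absurd h (by simp)
      | true =>
        rw [hc, cond_true] at h
        rw [Bool.and_eq_true, Nat.blt_eq] at hc
        obtain ⟨hpD, hSp⟩ := hc
        obtain ⟨hnd, hall, hcomp⟩ := hT ⟨p, hpD⟩
        -- the child evaluator is sound below `S`
        have hev : EvSoundBelow (D := D) (e₁ := e₁) (e₂ := e₂) (e₃ := e₃)
            (dfs D rows dg tab fuel) (bitCard (D := D) S) := by
          intro k c r w c' r' hk hkv
          exact ih k c r w c' r' (fun k' v' hk' hf => htab k' v' (hk'.trans hk) hf) hkv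
        have hsum := foldRow_sound (p := ⟨p, hpD⟩) htab hev ((rows.get? p).getD [])
          (fun di hdi => ⟨(hall di hdi).1, (hall di hdi).2.2⟩) 0 cur₁ rest₁ v cur' rest' h
        rw [hsum, zero_add, val_expand hb S (c := ⟨p, hpD⟩) hSp]
        -- list sum over the row = Finset sum over the diagonal masks through `p` inside `S`
        rw [show ((((rows.get? p).getD []).filter fun di => di.1 &&& S = di.1).map
            fun di => (-1) ^ expo e₁ e₂ e₃ di.1 S * val e₁ e₂ e₃ (S ^^^ di.1)) =
            (((((rows.get? p).getD []).map Prod.fst).filter fun d => d &&& S = d).map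
              fun d => (-1) ^ expo e₁ e₂ e₃ d S * val e₁ e₂ e₃ (S ^^^ d)) by
          rw [List.filter_map, List.map_map]; rfl]
        rw [← List.sum_toFinset _ (hnd.filter _)]
        apply Finset.sum_congr _ fun _ _ => rfl
        ext d
        rw [Finset.mem_filter, List.mem_toFinset, ← hAD.mem_iff, List.mem_toFinset, List.mem_filter,
          decide_eq_true_eq]
        constructor
        · rintro ⟨hd, hdp, hds⟩
          exact ⟨hcomp d hd hdp, hds⟩
        · rintro ⟨hd, hds⟩
          obtain ⟨di, hdi, rfl⟩ := List.mem_map.1 hd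
          exact ⟨(hall di hdi).2.1, (hall di hdi).1, hds⟩

/-- **Soundness of the table from the entry checks**: if every key of the table is a checked entry,
every stored value is the value of its key. [folklore] -/
private theorem tabSound_of_checkEntries (hb : Even b) {AD : List ℕ} (hAD : AD.Perm (allDiag e₁ e₂ e₃))
    {rows : BT (List (ℕ × ℕ))} {dg : BT (ℕ × List ℕ)} (hT : TabOK e₁ e₂ e₃ AD rows dg) {tab : ST}
    {E : List (ℕ × List ℕ)} (hE : checkEntries D rows dg tab E = true)
    (hkeys : ∀ k ∈ tab.keys, k ∈ E.map Prod.fst) :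
    ∀ n, TabSoundBelow (D := D) (e₁ := e₁) (e₂ := e₂) (e₃ := e₃) tab n := by
  intro n
  induction n with
  | zero => intro k v hk; exact absurd hk (Nat.not_lt_zero _)
  | succ n ih =>
    intro k v hk hf
    rcases Nat.lt_succ_iff_lt_or_eq.1 hk with hk' | hk'
    · exact ih k v hk' hf
    · -- `k` is a key of the table, hence a checked entry
      have hmem := hkeys k (ST.mem_keys_of_find hf)
      obtain ⟨e, heE, hek⟩ := List.mem_map.1 hmem
      unfold checkEntries at hE
      rw [List.all_eq_true] at hE
      have hce := hE e heE
      unfold checkEntry at hce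
      rw [hek, hf] at hce
      cases hd : dfs D rows dg tab D k 0 e.2 with
      | none => rw [hd] at hce; exact absurd hce (by simp)
      | some vcr =>
        obtain ⟨w, c, r⟩ := vcr
        rw [hd] at hce
        simp only [decide_eq_true_eq] at hce
        rw [← hce]
        exact dfs_sound hb hAD hT tab D k 0 e.2 w c r (hk' ▸ ih) hd

/-- **Soundness of the memoised certificate**: correct tables, all entries checked, every table key
an entry, and the full design a key with stored value `v` give `normSum = v`.
[cite: AmanovYeliussizov2022, Thm. 8.4 (ii) and Cor. 8.5] -/
theorem normSum_eq_of_checkEntries (hb : Even b) {AD : List ℕ} (hAD : AD.Perm (allDiag e₁ e₂ e₃))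
    {rows : BT (List (ℕ × ℕ))} {dg : BT (ℕ × List ℕ)} (hT : TabOK e₁ e₂ e₃ AD rows dg) {tab : ST}
    {E : List (ℕ × List ℕ)} (hE : checkEntries D rows dg tab E = true)
    (hkeys : ∀ k ∈ tab.keys, k ∈ E.map Prod.fst) {v : ℤ} (hv : tab.find (2 ^ D - 1) = some v) :
    DesignLM.normSum e₁ e₂ e₃ = v := by
  rw [← val_full]
  exact tabSound_of_checkEntries hb hAD hT hE hkeys _ _ v (Nat.lt_succ_self _) hv

end Evaluator

/-! ### §6 The certificate interface -/

section Certificate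

variable {m δ : ℕ} [NeZero δ] [NeZero m]

/-- **Memoised design certificate ⇒ `k_m(δ) > 0`** (even `δ`): three block structures on `m·δ`
positions; tables `rows`/`dg` passing `tabCheck` against a reference list `AD` of all diagonals (a
permutation of the letter-major stage-1 lists); a table `tab` of shared values whose keys, in
order, are the keys of the checked entries `E` (with their advice streams); and a nonzero stored
value for the full design — all premises are `decide`d in the certificate files. Then
`0 < kronRect k m δ`.
[cite: BurgisserIkenmeyer2017, Thm. 5.9 (proof of (2))] [cite: AmanovYeliussizov2022, Thm. 8.4 and Cor. 8.5] -/
theorem kronRect_pos_of_checkEntries (k : Type*) [Field k] [CharZero k] (hδ : Even δ)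
    (e₁ e₂ e₃ : Fin (m * δ) ≃ Fin δ × Fin m) {AD : List ℕ} (hAD : AD.Perm (allDiag e₁ e₂ e₃))
    {rows : BT (List (ℕ × ℕ))} {dg : BT (ℕ × List ℕ)} {nd : ℕ}
    (hT : tabCheck e₁ e₂ e₃ AD rows dg nd = true) {tab : ST} {E : List (ℕ × List ℕ)}
    (hE : checkEntries (m * δ) rows dg tab E = true) (hkeys : tab.keys = E.map Prod.fst)
    {v : ℤ} (hv : tab.find (2 ^ (m * δ) - 1) = some v) (hv0 : v ≠ 0) : 0 < kronRect k m δ := by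
  refine DesignLM.kronRect_pos_of_normSum_ne_zero k hδ e₁ e₂ e₃ ?_
  rw [normSum_eq_of_checkEntries hδ hAD (tabOK_of_tabCheck e₁ e₂ e₃ hT) hE
    (fun k hk => hkeys ▸ hk) hv]
  exact hv0

end Certificate

end DesignDAG

end Literature.Computability.AlgebraicComplexity
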